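import Mathlib
import Literature.Analysis.SpecialFunctions.LegendrePolynomialsBonnet
import Literature.Analysis.SpecialFunctions.LegendreNikolskii
import Literature.Analysis.SpecialFunctions.LegendreDifferentialRelation
import Literature.Analysis.SpecialFunctions.LegendreHilbertBasis
import Literature.Analysis.FunctionSpaces.BesselJIComplexOrder
import HarnessLib

/-!
# Spherical Bessel functions of the first kind `j_n(x)`, real argument

Literature anchor for the engines' `cap.special.sphbessel` (engines release `cap` 0.2.24, module
version `cap.special.sphbessel/0.1.0`): rigorous interval enclosures of `j_l(x)` for integer `l ≥ 0`
and real `x` by INDEPENDENT METHODS whose results are intersected — (a) the ascending power series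
with a rigorous tail, (b) the finite trigonometric (Rayleigh) form, (c) optionally Arb's
`√(π/(2x)) J_{l+½}(x)`.  HONEST FRAMING: the engines are shared numerical code serving client cells;
rigour lives in the verifiers; this file certifies the mathematics the code relies on — that the three
formulas denote one real number `j_l(x)`, that the series stopping rule bounds the tail, that the
mean-value radius is valid — not any run of the code.  Every public declaration below is a published
statement (or a routine special case of one) with its source; the dictionary lets a verifier match
each program step to a theorem.

Neither Mathlib nor the tree had spherical Bessel functions (the tree has `J_ν` of complex order,
`Literature.Analysis.FunctionSpaces.besselJC`).  We DEFINE `j_n(x)` for `n ∈ ℕ`, `x ∈ ℝ` by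
Gegenbauer's generalisation of Poisson's integral (A&S 10.1.14),
`j_n(x) = ½(-i)ⁿ ∫_{-1}^{1} e^{ixt} P_n(t) dt` (`P_n` = the tree's Rodrigues `legendre n`), which makes
`|j_n| ≤ 1` immediate (`|P_n| ≤ 1`), the recurrence one integration by parts against
`P'_{n+2} - P'_n = (2n+3) P_{n+1}`, and the derivative a differentiation under the integral sign; and we
PROVE from it: the identification `j_n(x) = √(π/(2x)) J_{n+½}(x)` (`x > 0`, A&S 10.1.1, method (c)),
the ascending series A&S 10.1.2 = DLMF 10.53.1 with the program's term recursion and its rigorous tail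
(method (a)), `|j_n'| ≤ 1` (the mean-value form), Rayleigh's finite form with integer polynomials in
`1/x` (method (b)), `j_0, j_1, j_2`, the recurrences A&S 10.1.19–10.1.22, the reflection rule, and
the square-sum identity A&S 10.1.50 (Parseval for Rayleigh's expansion 10.1.47 in the tree's Legendre
Hilbert basis).  The series comes from the integral by expanding `e^{ixt}` and integrating termwise
(dominated convergence); the moments `∫_{-1}^1 t^{n+2k} P_n = 2 (n+2k)! / (2ᵏ k! (2n+2k+1)!!)` come
from Rodrigues' formula, `n` integrations by parts and the Beta-type integral `∫_{-1}^1 t^{2k}(1-t²)ⁿ`.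

## Sources (statements checked against the cited formulas)

* `AbramowitzStegun1964` §10.1: 10.1.1 (`j_n(z) = √(½π/z) J_{n+½}(z)`), 10.1.2 (ascending series
  `zⁿ/(1·3·5⋯(2n+1)) · {1 - (½z²)/(1!(2n+3)) + (½z²)²/(2!(2n+3)(2n+5)) - ⋯}`), 10.1.4 (behaviour at
  `0`), 10.1.10 (`j_n = f_n sin z + (-1)^{n+1} f_{-n-1} cos z`, `f_{n-1} + f_{n+1} = (2n+1) z⁻¹ f_n`),
  10.1.11 (`j_0 = sin z/z`, `j_1 = sin z/z² - cos z/z`, `j_2 = (3/z³ - 1/z) sin z - (3/z²) cos z`),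
  10.1.13–10.1.14 (Poisson's integral and Gegenbauer's generalisation
  `j_n(z) = (zⁿ/2^{n+1} n!) ∫_0^π cos(z cos θ) sin^{2n+1}θ dθ = ½(-i)ⁿ ∫_0^π e^{iz cos θ} P_n(cos θ) sin θ dθ`),
  10.1.19–10.1.22 (recurrence and derivative relations for `f_n = j_n`), 10.1.47
  (`e^{iz cos θ} = Σ (2n+1) iⁿ j_n(z) P_n(cos θ)`), 10.1.50 (`Σ₀^∞ (2n+1) j_n²(z) = 1`); 22.14.7
  (`|P_n(x)| ≤ 1`, used through the tree's `abs_eval_legendre_le_one`).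
* `Watson1944` §3.1 (8) (the series of `J_ν`, the tree's `besselJC`), §3.32 (Gegenbauer's
  generalisation of Poisson's integral).
* `Arfken1985` (3rd ed.): (12.23) `P'_{n+1} - P'_{n-1} = (2n+1) P_n`, (12.27)
  `(1-x²) P'_n = (n+1) x P_n - (n+1) P_{n+1}`, (12.37) parity `P_n(-x) = (-1)ⁿ P_n(x)`; §11.7
  ((11.144) the series, (11.161)–(11.164) the recurrences; cross-checked).
* `DLMF` 10.47.3 (definition), 10.47.14 (reflection), 10.49 (i) (explicit forms), 10.51.1–10.51.2
  (recurrences, derivatives), 10.53.1 (power series), 10.54.2 (Gegenbauer's integral) — as the program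
  cites them; each matches the A&S item used here.
* `AndrewsAskeyRoy1999` (2.5.14) (orthogonality, through the tree's `integral_legendre_mul_eq_zero`);
  Mathlib's `Real.Gamma_nat_add_one_add_half` (`Γ(m + 3/2) = (2m+1)!! √π / 2^{m+1}`).

## Dictionary to `engines/eng-cap-1/release/cap-0.2.24/cap/special/sphbessel.py`

* The number enclosed, `j_l(x)` (`l ≥ 0` integer, `x` real) ↔ `sphBesselJ l x`.  All methods enclose
  the SAME real number, which is what makes `sph_bessel_j`'s intersection sound and `Disagreement`
  (disjoint enclosures) a genuine bug signal: (a) ↔ `hasSum_sphBesselJ` / `sphBesselJ_eq_prefactor_mul_tsum`,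
  (b) ↔ `sphBesselJ_eq_rayleigh`, (c) ↔ `sphBesselJ_eq_re_sqrt_mul_besselJC` (`x > 0`; negative `x`
  by the reflection `sphBesselJ_neg`, the program's `if neg and l % 2: V = -V`).
* `double_factorial_odd(l) = (2l+1)!!` ↔ `Nat.doubleFactorial (2*l+1)`;
  `(2l+1)!! ∏_{i<k}(2l+2i+3) = (2l+2k+1)!!` ↔ `doubleFactorial_mul_prod_range`.
* `_series_direct`: `Y = X²/2`, `t_0 = 1`, `t_k = t_{k-1} · Y/(k(2l+2k+1))`, `terms = [±t_k]`
  (sign `(-1)^k`), `S = Σ terms + [-tail, tail]`, `pref = X**l/(2l+1)!!`, `J = pref · S`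
  ↔ `sphBesselJRedTerm` (`u_k = (-1)^k t_k`), `sphBesselJRedTerm_zero`, `sphBesselJRedTerm_succ`,
  `sphBesselJ_eq_prefactor_mul_tsum` (`j_l = pref · Σ u_k`, all real `x`); equivalently
  `sphBesselJTerm`, `sphBesselJTerm_succ`, `sphBesselJTerm_eq_prefactor_mul`, `hasSum_sphBesselJ`.
  The stopping rule `rho = ymax/((k+1)(2l+2k+3))` (a bound for every later term ratio, which
  decrease in `k` and increase in `y`), `tail = t.hi · rho/(1 - rho)` ↔
  `abs_tsum_sphBesselJRedTerm_sub_sum_le` / `abs_sphBesselJ_sub_sum_le` with `K = k`: any `ρ` with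
  `(x²/2)/((K+1)(2l+2K+3)) ≤ ρ < 1` gives `|S - S_K| ≤ |u_K| ρ/(1-ρ)` (monotone in `|u_K| ≤ t.hi` and in
  `ρ ≤ rho`; the program additionally insists on `rho < ½`); the ratio facts ↔ `abs_sphBesselJTerm_succ`,
  `abs_sphBesselJTerm_add_le`.  `X ∋ 0` is allowed: `sphBesselJ_zero_zero`, `sphBesselJ_succ_zero`.
* `_series` mean-value form `j_l(mid X) + [-r, r]` and `_arb`'s radius ("`|j_l'(t)| ≤ 1` for real `t`:
  `j_l' = (l j_{l-1} - (l+1) j_{l+1})/(2l+1)`, `|j_n| ≤ 1`") ↔ `hasDerivAt_sphBesselJ` with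
  `sphBesselJDeriv` (A&S 10.1.20; the `l = 0` case `j_0' = -j_1`), `abs_sphBesselJ_le_one`,
  `abs_sphBesselJDeriv_le_one`, `abs_deriv_sphBesselJ_le_one`, `lipschitzWith_sphBesselJ`,
  `abs_sphBesselJ_sub_le` (`|j_l(t) - j_l(m)| ≤ |t - m|`), `sphBesselJ_mem_Icc_of_abs_sub_le`.
* `rayleigh_polys(l)` (`_RAY = {0: ([0,1],[0]), 1: ([0,0,1],[0,-1])}`, ascending powers of `t = 1/x`;
  `step`: `C_{l+1} = (2l+1) t C_l - C_{l-1}`) ↔ `rayleighA`, `rayleighB : ℕ → ℤ[X]`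
  (`rayleighA_zero = X`, `rayleighA_one = X^2`, `rayleighB_zero = 0`, `rayleighB_one = -X`,
  `rayleighA_add_two`, `rayleighB_add_two`); `_closed`: `J = A_l(1/X) sin X + B_l(1/X) cos X` for
  `0 ∉ X` ↔ `sphBesselJ_eq_rayleigh` (every real `x ≠ 0`, either sign), from `sphBesselJ_zero_left`,
  `sphBesselJ_one_left` (A&S 10.1.11) and the recurrence `sphBesselJ_add_two` / `sphBesselJ_rec`
  (A&S 10.1.19); `sphBesselJ_two_left` is A&S's `j_2` as a check.
* `_arb`: `V = √(π/(2|x|)) J_{l+½}(|x|)`, sign `(-1)^l` for `x < 0` ↔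
  `ofReal_sphBesselJ_eq_sqrt_mul_besselJC`, `sphBesselJ_neg`.

## Main statements

* `sphBesselJ`, `abs_sphBesselJ_le_one`, `sphBesselJ_zero_left` (`j_0 = sin x / x`),
  `sphBesselJ_one_left`, `sphBesselJ_two_left`, `sphBesselJ_zero_zero`, `sphBesselJ_succ_zero`;
* `sphBesselJ_rec` (`x (j_n + j_{n+2}) = (2n+3) j_{n+1}`), `hasDerivAt_sphBesselJ`,
  `sphBesselJDeriv_succ_eq_sub`, `sphBesselJDeriv_succ_eq_sub'` (A&S 10.1.19–10.1.22),
  `abs_sphBesselJDeriv_le_one`, `abs_sphBesselJ_sub_le`;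
* `sphBesselJ_eq_rayleigh` (finite trigonometric form with `rayleighA`, `rayleighB ∈ ℤ[X]`);
* `hasSum_sphBesselJ` (`j_n(x) = Σ_k (-1)^k x^{n+2k} / (2ᵏ k! (2n+2k+1)!!)`), `sphBesselJTerm_succ`,
  `abs_sphBesselJ_sub_sum_le` and `abs_tsum_sphBesselJRedTerm_sub_sum_le` (rigorous tails),
  `sphBesselJ_neg` (reflection), `legendreMoment_add_two_mul` (the moments of `P_n`);
* `inner_legendreL2_cexp` (A&S 10.1.47 as a Legendre coefficient), `hasSum_sq_sphBesselJ`
  (`Σ (2n+1) j_n(x)² = 1`);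
* `ofReal_sphBesselJ_eq_sqrt_mul_besselJC` (`j_n(x) = √(π/(2x)) J_{n+½}(x)`, `x > 0`).
-/

open Polynomial intervalIntegral MeasureTheory Set Filter Complex
open scoped Nat Real Topology ComplexConjugate Interval InnerProductSpace

namespace Literature.Analysis.SpecialFunctions

/-! ### Gegenbauer's integral and the definition -/

/-- The integrand `e^{ixt} P_n(t)` of Gegenbauer's generalisation of Poisson's integral.
[cite: AbramowitzStegun1964, 10.1.14] -/
noncomputable def gegenbauerKernel (n : ℕ) (x t : ℝ) : ℂ :=
  cexp (I * x * t) * (((legendre n).eval t : ℝ) : ℂ)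

/-- Gegenbauer's integral `G_n(x) = ∫_{-1}^{1} e^{ixt} P_n(t) dt`
(`= ∫_0^π e^{ix cos θ} P_n(cos θ) sin θ dθ`). [cite: AbramowitzStegun1964, 10.1.14] -/
noncomputable def gegenbauerIntegral (n : ℕ) (x : ℝ) : ℂ :=
  ∫ t in (-1 : ℝ)..1, gegenbauerKernel n x t

/-- **The spherical Bessel function of the first kind** `j_n(x)`, `n ∈ ℕ`, `x ∈ ℝ`, defined by
Gegenbauer's generalisation of Poisson's integral
`j_n(x) = ½ (-i)ⁿ ∫_{-1}^{1} e^{ixt} P_n(t) dt` (the integral is real, `im_negI_pow_mul_gegenbauerIntegral`;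
it equals `√(π/(2x)) J_{n+½}(x)` for `x > 0`, `ofReal_sphBesselJ_eq_sqrt_mul_besselJC`, and the sum
of the ascending series, `hasSum_sphBesselJ`).
[cite: AbramowitzStegun1964, 10.1.14] [cite: Watson1944, §3.32 (2)] -/
noncomputable def sphBesselJ (n : ℕ) (x : ℝ) : ℝ :=
  ((-I) ^ n / 2 * gegenbauerIntegral n x).re

/-- Unfolding the integrand `e^{ixt} P_n(t)`. [cite: AbramowitzStegun1964, 10.1.14] -/
theorem gegenbauerKernel_apply (n : ℕ) (x t : ℝ) :
    gegenbauerKernel n x t = cexp (I * x * t) * (((legendre n).eval t : ℝ) : ℂ) := rfl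

/-- The integrand is continuous in `t`. [cite: AbramowitzStegun1964, 10.1.14] -/
theorem continuous_gegenbauerKernel (n : ℕ) (x : ℝ) : Continuous (gegenbauerKernel n x) := by
  unfold gegenbauerKernel; fun_prop

/-- The integrand is continuous in `x`. [cite: AbramowitzStegun1964, 10.1.14] -/
theorem continuous_gegenbauerKernel_left (n : ℕ) (t : ℝ) :
    Continuous (fun x => gegenbauerKernel n x t) := by
  unfold gegenbauerKernel; fun_prop

/-- The integrand is integrable on every interval. [cite: AbramowitzStegun1964, 10.1.14] -/
theorem intervalIntegrable_gegenbauerKernel (n : ℕ) (x a b : ℝ) :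
    IntervalIntegrable (gegenbauerKernel n x) volume a b :=
  (continuous_gegenbauerKernel n x).intervalIntegrable _ _

/-- `|e^{ixt}| = 1`. [folklore] -/
private theorem norm_cexp_I_mul_mul (x t : ℝ) : ‖cexp (I * x * t)‖ = 1 := by
  rw [show I * (x : ℂ) * t = I * ((x * t : ℝ) : ℂ) by push_cast; ring]
  exact norm_exp_I_mul_ofReal _

/-- `|e^{ixt} P_n(t)| ≤ 1` on `[-1, 1]` (since `|P_n| ≤ 1` there).
[cite: AbramowitzStegun1964, 22.14.7] -/
theorem norm_gegenbauerKernel_le (n : ℕ) (x : ℝ) {t : ℝ} (ht : t ∈ Icc (-1 : ℝ) 1) :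
    ‖gegenbauerKernel n x t‖ ≤ 1 := by
  rw [gegenbauerKernel, norm_mul, norm_cexp_I_mul_mul, one_mul, norm_real, Real.norm_eq_abs]
  exact abs_eval_legendre_le_one n (abs_le.mpr ⟨ht.1, ht.2⟩)

/-- `‖G_n(x)‖ ≤ 2`. [cite: AbramowitzStegun1964, 10.1.14] -/
theorem norm_gegenbauerIntegral_le (n : ℕ) (x : ℝ) : ‖gegenbauerIntegral n x‖ ≤ 2 := by
  have h := intervalIntegral.norm_integral_le_of_norm_le_const (a := (-1 : ℝ)) (b := 1) (C := 1)
    (f := gegenbauerKernel n x) (fun t ht => by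
      rw [uIoc_of_le (by norm_num)] at ht
      exact norm_gegenbauerKernel_le n x ⟨ht.1.le, ht.2⟩)
  norm_num at h
  exact h

/-! ### Reality: `t ↦ -t` -/

/-- `e^{ix(-t)} P_n(-t) = (-1)ⁿ · conj (e^{ixt} P_n(t))`. [folklore] -/
private theorem gegenbauerKernel_neg (n : ℕ) (x t : ℝ) :
    gegenbauerKernel n x (-t) = (-1) ^ n * conj (gegenbauerKernel n x t) := by
  rw [gegenbauerKernel, gegenbauerKernel, map_mul, ← exp_conj, map_mul, map_mul, conj_I,
    conj_ofReal, conj_ofReal, conj_ofReal, eval_neg_legendre]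
  push_cast
  rw [show I * (x : ℂ) * -(t : ℂ) = -I * x * t by ring]
  ring

/-- `conj G_n(x) = (-1)ⁿ G_n(x)`. [cite: AbramowitzStegun1964, 10.1.14] -/
theorem conj_gegenbauerIntegral (n : ℕ) (x : ℝ) :
    conj (gegenbauerIntegral n x) = (-1) ^ n * gegenbauerIntegral n x := by
  unfold gegenbauerIntegral
  rw [← intervalIntegral_conj]
  have h : ∀ t, conj (gegenbauerKernel n x t) = (-1) ^ n * gegenbauerKernel n x (-t) := by
    intro t
    rw [gegenbauerKernel_neg, ← mul_assoc, ← mul_pow]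
    norm_num
  simp_rw [h, intervalIntegral.integral_const_mul]
  rw [intervalIntegral.integral_comp_neg (fun t => gegenbauerKernel n x t)]
  norm_num

/-- `½ (-i)ⁿ G_n(x)` is invariant under conjugation. [folklore] -/
private theorem conj_negI_pow_mul_gegenbauerIntegral (n : ℕ) (x : ℝ) :
    conj ((-I) ^ n / 2 * gegenbauerIntegral n x) = (-I) ^ n / 2 * gegenbauerIntegral n x := by
  rw [map_mul, map_div₀, map_pow, map_neg, conj_I, neg_neg, conj_gegenbauerIntegral, map_ofNat]
  have : (-I) ^ n = I ^ n * (-1) ^ n := by rw [← mul_pow, mul_neg_one]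
  rw [this]
  ring

/-- Gegenbauer's integral `½ (-i)ⁿ ∫_{-1}^1 e^{ixt} P_n(t) dt` is real.
[cite: AbramowitzStegun1964, 10.1.14] -/
theorem im_negI_pow_mul_gegenbauerIntegral (n : ℕ) (x : ℝ) :
    ((-I) ^ n / 2 * gegenbauerIntegral n x).im = 0 :=
  conj_eq_iff_im.mp (conj_negI_pow_mul_gegenbauerIntegral n x)

/-- `j_n(x) = ½ (-i)ⁿ ∫_{-1}^1 e^{ixt} P_n(t) dt` as complex numbers.
[cite: AbramowitzStegun1964, 10.1.14] -/
theorem ofReal_sphBesselJ (n : ℕ) (x : ℝ) :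
    (sphBesselJ n x : ℂ) = (-I) ^ n / 2 * gegenbauerIntegral n x := by
  apply Complex.ext
  · simp [sphBesselJ]
  · rw [ofReal_im, im_negI_pow_mul_gegenbauerIntegral]

/-! ### The bound `|j_n(x)| ≤ 1` -/

/-- **`|j_n(x)| ≤ 1`** for all `n` and all real `x` (from Gegenbauer's integral and `|P_n| ≤ 1`;
cf. `Σ (2n+1) j_n² = 1`). [cite: AbramowitzStegun1964, 10.1.14 with 22.14.7; cf. 10.1.50] -/
theorem abs_sphBesselJ_le_one (n : ℕ) (x : ℝ) : |sphBesselJ n x| ≤ 1 := by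
  have h1 : |sphBesselJ n x| ≤ ‖(-I) ^ n / 2 * gegenbauerIntegral n x‖ := abs_re_le_norm _
  have h2 : ‖(-I) ^ n / 2 * gegenbauerIntegral n x‖ = ‖gegenbauerIntegral n x‖ / 2 := by
    rw [norm_mul, norm_div, norm_pow, norm_neg, norm_I, one_pow, Complex.norm_two]
    ring
  linarith [norm_gegenbauerIntegral_le n x]

/-! ### `j_0`, and the values at `0` -/

/-- `G_0(x) = ∫_{-1}^1 e^{ixt} dt` (`P_0 = 1`). [cite: AbramowitzStegun1964, 10.1.14] -/
theorem gegenbauerIntegral_zero_left (x : ℝ) :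
    gegenbauerIntegral 0 x = ∫ t in (-1 : ℝ)..1, cexp (I * x * t) := by
  unfold gegenbauerIntegral gegenbauerKernel
  simp [legendre_zero]

/-- `∫_{-1}^1 e^{ixt} dt = 2 sin x / x` (`x ≠ 0`). [cite: AbramowitzStegun1964, 10.1.11 with 10.1.14] -/
theorem gegenbauerIntegral_zero_left_of_ne_zero {x : ℝ} (hx : x ≠ 0) :
    gegenbauerIntegral 0 x = 2 * Complex.sin x / x := by
  have hx' : (x : ℂ) ≠ 0 := ofReal_ne_zero.mpr hx
  have hc : I * (x : ℂ) ≠ 0 := mul_ne_zero I_ne_zero hx'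
  rw [gegenbauerIntegral_zero_left, integral_exp_mul_complex hc, div_eq_div_iff hc hx']
  push_cast
  rw [mul_one, mul_neg_one, mul_comm I (x : ℂ), ← neg_mul, exp_mul_I, exp_mul_I,
    Complex.cos_neg, Complex.sin_neg]
  ring

/-- **`j_0(x) = sin x / x`** (`x ≠ 0`). [cite: AbramowitzStegun1964, 10.1.11] -/
theorem sphBesselJ_zero_left {x : ℝ} (hx : x ≠ 0) : sphBesselJ 0 x = Real.sin x / x := by
  have h : ((sphBesselJ 0 x : ℝ) : ℂ) = ((Real.sin x / x : ℝ) : ℂ) := by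
    rw [ofReal_sphBesselJ, gegenbauerIntegral_zero_left_of_ne_zero hx]
    push_cast
    field_simp
  exact_mod_cast h

/-- `j_0(0) = 1`. [cite: AbramowitzStegun1964, 10.1.4] -/
theorem sphBesselJ_zero_zero : sphBesselJ 0 0 = 1 := by
  have h : ((sphBesselJ 0 0 : ℝ) : ℂ) = 1 := by
    rw [ofReal_sphBesselJ, gegenbauerIntegral_zero_left]
    norm_num
  exact_mod_cast h

/-- `G_n(0) = ∫_{-1}^1 P_n = 0` for `n ≥ 1` (orthogonality to `P_0`). [cite: AbramowitzStegun1964, 10.1.4 with 10.1.14] -/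
theorem gegenbauerIntegral_succ_zero (n : ℕ) : gegenbauerIntegral (n + 1) 0 = 0 := by
  unfold gegenbauerIntegral gegenbauerKernel
  simp only [ofReal_zero, mul_zero, zero_mul, Complex.exp_zero, one_mul]
  rw [intervalIntegral.integral_ofReal]
  have h := integral_legendre_mul_eq_zero (n := n + 1) (q := 1)
    (by rw [degree_one]; exact_mod_cast Nat.succ_pos n)
  simp only [eval_one, mul_one] at h
  rw [h]; simp

/-- `j_n(0) = 0` for `n ≥ 1`. [cite: AbramowitzStegun1964, 10.1.4] -/
theorem sphBesselJ_succ_zero (n : ℕ) : sphBesselJ (n + 1) 0 = 0 := by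
  have h : ((sphBesselJ (n + 1) 0 : ℝ) : ℂ) = 0 := by
    rw [ofReal_sphBesselJ, gegenbauerIntegral_succ_zero, mul_zero]
  exact_mod_cast h

/-! ### The three-term recurrence (A&S 10.1.19) -/

/-- The differential relation in the second index form:
`(X² - 1) P'_n = (n+1) (P_{n+1} - X P_n)`. [cite: Arfken1985, (12.27)] (from Bonnet's recursion and
`X_sq_sub_one_mul_derivative_legendre`; Jeffrey 1995 §18.2.5.1) -/
theorem X_sq_sub_one_mul_derivative_legendre' (n : ℕ) :
    (X ^ 2 - 1) * derivative (legendre n) =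
      ((n : ℝ[X]) + 1) * (legendre (n + 1) - X * legendre n) := by
  cases n with
  | zero => simp [legendre_zero, legendre_one]
  | succ m =>
    have h3 := X_sq_sub_one_mul_derivative_legendre m
    have hb := legendre_succ_succ m
    simp only [map_add, map_mul, map_natCast, map_ofNat, map_one] at hb
    rw [show m + 1 + 1 = m + 2 from rfl]
    push_cast
    linear_combination h3 - hb

/-- **`P'_{n+2} - P'_n = (2n+3) P_{n+1}`**. [cite: Arfken1985, (12.23)] (Jeffrey 1995 §18.2.5.1; from the two index
forms of the differential relation and Bonnet's recursion, cancelling `X² - 1` in `ℝ[X]`) -/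
theorem derivative_legendre_add_two_sub (n : ℕ) :
    derivative (legendre (n + 2)) - derivative (legendre n) =
      (2 * (n : ℝ[X]) + 3) * legendre (n + 1) := by
  have hX : (X ^ 2 - 1 : ℝ[X]) ≠ 0 := by
    intro h
    have := congrArg (fun p : ℝ[X] => p.eval 2) h
    norm_num at this
  apply mul_left_cancel₀ hX
  have h1 := X_sq_sub_one_mul_derivative_legendre (n + 1)
  have h2 := X_sq_sub_one_mul_derivative_legendre' n
  have hb := legendre_succ_succ n
  simp only [map_add, map_mul, map_natCast, map_ofNat, map_one] at hb
  rw [show n + 1 + 1 = n + 2 from rfl] at h1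
  push_cast at h1
  linear_combination h1 - h2 + X * hb

/-- The same at a point: `P'_{n+2}(t) - P'_n(t) = (2n+3) P_{n+1}(t)`. [cite: Arfken1985, (12.23)] -/
theorem eval_derivative_legendre_add_two_sub (n : ℕ) (t : ℝ) :
    (derivative (legendre (n + 2))).eval t - (derivative (legendre n)).eval t =
      (2 * n + 3) * (legendre (n + 1)).eval t := by
  have h := congrArg (fun p => p.eval t) (derivative_legendre_add_two_sub n)
  simpa only [eval_sub, eval_mul, eval_add, eval_ofNat, eval_natCast, eval_X] using h

/-- `e^{ixt}` has `t`-derivative `ix e^{ixt}`. [folklore] -/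
private theorem hasDerivAt_cexp_I_mul_mul_right (x t : ℝ) :
    HasDerivAt (fun s : ℝ => cexp (I * x * s)) (I * x * cexp (I * x * t)) t := by
  have h1 : HasDerivAt (fun z : ℂ => cexp (I * x * z)) (cexp (I * x * t) * (I * x)) (t : ℂ) := by
    have h := ((hasDerivAt_id (t : ℂ)).const_mul (I * x)).cexp
    simpa using h
  simpa [mul_comm] using h1.comp_ofReal

/-- `e^{ixt}` has `x`-derivative `it e^{ixt}`. [folklore] -/
private theorem hasDerivAt_cexp_I_mul_mul_left (x t : ℝ) :
    HasDerivAt (fun y : ℝ => cexp (I * y * t)) (I * t * cexp (I * x * t)) x := by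
  have h1 : HasDerivAt (fun z : ℂ => cexp (I * z * t)) (cexp (I * x * t) * (I * t)) (x : ℂ) := by
    have h := (((hasDerivAt_id (x : ℂ)).const_mul I).mul_const (t : ℂ)).cexp
    simpa using h
  simpa [mul_comm] using h1.comp_ofReal

/-- **Gegenbauer's integral satisfies `(2n+3) G_{n+1}(x) = ix (G_n(x) - G_{n+2}(x))`**
(integration by parts against `P'_{n+2} - P'_n = (2n+3) P_{n+1}`, the boundary terms vanishing
because `P_{n+2}(±1) = P_n(±1)`). [cite: AbramowitzStegun1964, 10.1.19 with 10.1.14] -/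
theorem gegenbauerIntegral_rec (n : ℕ) (x : ℝ) :
    (2 * n + 3) * gegenbauerIntegral (n + 1) x =
      I * x * (gegenbauerIntegral n x - gegenbauerIntegral (n + 2) x) := by
  have hparts := intervalIntegral.integral_mul_deriv_eq_deriv_mul (a := (-1 : ℝ)) (b := 1)
    (u := fun t : ℝ => cexp (I * x * t)) (u' := fun t : ℝ => I * x * cexp (I * x * t))
    (v := fun t : ℝ => (((legendre (n + 2) - legendre n).eval t : ℝ) : ℂ))
    (v' := fun t : ℝ => (((derivative (legendre (n + 2) - legendre n)).eval t : ℝ) : ℂ))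
    (fun t _ => hasDerivAt_cexp_I_mul_mul_right x t)
    (fun t _ => ((legendre (n + 2) - legendre n).hasDerivAt t).ofReal_comp)
    (Continuous.intervalIntegrable (by fun_prop) _ _)
    (Continuous.intervalIntegrable (by fun_prop) _ _)
  have hb1 : (legendre (n + 2) - legendre n).eval 1 = 0 := by simp [eval_one_legendre]
  have hb2 : (legendre (n + 2) - legendre n).eval (-1) = 0 := by
    simp [eval_neg_one_legendre]; ring
  have hL : ∀ t : ℝ, cexp (I * x * t) * (((derivative (legendre (n + 2) - legendre n)).eval t : ℝ) : ℂ) =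
      (2 * n + 3 : ℂ) * gegenbauerKernel (n + 1) x t := by
    intro t
    rw [derivative_sub, eval_sub, eval_derivative_legendre_add_two_sub, gegenbauerKernel]
    push_cast; ring
  have hR : ∀ t : ℝ, I * x * cexp (I * x * t) * (((legendre (n + 2) - legendre n).eval t : ℝ) : ℂ) =
      I * x * (gegenbauerKernel (n + 2) x t - gegenbauerKernel n x t) := by
    intro t
    rw [eval_sub, gegenbauerKernel, gegenbauerKernel]
    push_cast; ring
  simp only [hb1, hb2, hL, hR, ofReal_zero, mul_zero, sub_zero, zero_sub,
    intervalIntegral.integral_const_mul] at hparts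
  rw [intervalIntegral.integral_sub (intervalIntegrable_gegenbauerKernel _ _ _ _)
    (intervalIntegrable_gegenbauerKernel _ _ _ _)] at hparts
  unfold gegenbauerIntegral
  linear_combination hparts

/-- **The three-term recurrence `j_{n-1}(x) + j_{n+1}(x) = (2n+1) x⁻¹ j_n(x)`**, in the
polynomial form `x (j_n(x) + j_{n+2}(x)) = (2n+3) j_{n+1}(x)` valid for every real `x`.
[cite: AbramowitzStegun1964, 10.1.19] -/
theorem sphBesselJ_rec (n : ℕ) (x : ℝ) :
    x * (sphBesselJ n x + sphBesselJ (n + 2) x) = (2 * n + 3) * sphBesselJ (n + 1) x := by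
  have h := gegenbauerIntegral_rec n x
  have key : ((x * (sphBesselJ n x + sphBesselJ (n + 2) x) : ℝ) : ℂ) =
      (((2 * n + 3) * sphBesselJ (n + 1) x : ℝ) : ℂ) := by
    push_cast
    rw [ofReal_sphBesselJ, ofReal_sphBesselJ, ofReal_sphBesselJ]
    simp only [pow_succ]
    linear_combination ((-I) ^ n * I / 2) * h +
      ((x : ℂ) * (-I) ^ n / 2 * gegenbauerIntegral n x) * I_sq
  exact_mod_cast key

/-- The recurrence solved for `j_{n+2}`: `j_{n+2}(x) = (2n+3) x⁻¹ j_{n+1}(x) - j_n(x)` (`x ≠ 0`);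
this is the recursion generating the program's Rayleigh polynomials.
[cite: AbramowitzStegun1964, 10.1.19] -/
theorem sphBesselJ_add_two {x : ℝ} (hx : x ≠ 0) (n : ℕ) :
    sphBesselJ (n + 2) x = (2 * n + 3) / x * sphBesselJ (n + 1) x - sphBesselJ n x := by
  have h := sphBesselJ_rec n x
  field_simp
  linear_combination h

/-! ### Differentiation under the integral sign (A&S 10.1.20–10.1.22) -/

/-- `x`-derivative of the integrand: `∂/∂x (e^{ixt} P_n(t)) = it · e^{ixt} P_n(t)`. [folklore] -/
private theorem hasDerivAt_gegenbauerKernel (n : ℕ) (x t : ℝ) :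
    HasDerivAt (fun y : ℝ => gegenbauerKernel n y t) (I * t * gegenbauerKernel n x t) x := by
  have h := (hasDerivAt_cexp_I_mul_mul_left x t).mul_const (((legendre n).eval t : ℝ) : ℂ)
  simp only [gegenbauerKernel, ← mul_assoc] at h ⊢
  exact h

/-- **Differentiation under the integral sign**: `G_n'(x) = ∫_{-1}^1 it e^{ixt} P_n(t) dt`
(dominated convergence, the `x`-derivative of the integrand being bounded by `1` on `[-1, 1]`).
[cite: AbramowitzStegun1964, 10.1.14] -/
theorem hasDerivAt_gegenbauerIntegral (n : ℕ) (x : ℝ) :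
    HasDerivAt (gegenbauerIntegral n)
      (∫ t in (-1 : ℝ)..1, I * t * gegenbauerKernel n x t) x := by
  have h := intervalIntegral.hasDerivAt_integral_of_dominated_loc_of_deriv_le
    (𝕜 := ℝ) (μ := volume) (a := (-1 : ℝ)) (b := 1) (E := ℂ) (bound := fun _ => 1)
    (F := fun y t => gegenbauerKernel n y t) (F' := fun y t => I * t * gegenbauerKernel n y t)
    (x₀ := x) (s := univ) Filter.univ_mem
    (Filter.Eventually.of_forall fun y => (continuous_gegenbauerKernel n y).aestronglyMeasurable)
    (intervalIntegrable_gegenbauerKernel n x _ _)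
    (((continuous_const.mul continuous_ofReal).mul
      (continuous_gegenbauerKernel n x)).aestronglyMeasurable :
      AEStronglyMeasurable (fun t : ℝ => I * t * gegenbauerKernel n x t) _)
    (Filter.Eventually.of_forall fun t ht y _ => by
      rw [uIoc_of_le (by norm_num)] at ht
      calc ‖I * t * gegenbauerKernel n y t‖ = |t| * ‖gegenbauerKernel n y t‖ := by
            rw [norm_mul, norm_mul, norm_I, one_mul, norm_real, Real.norm_eq_abs]
        _ ≤ 1 * 1 :=
            mul_le_mul (abs_le.mpr ⟨ht.1.le, ht.2⟩) (norm_gegenbauerKernel_le n y ⟨ht.1.le, ht.2⟩)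
              (norm_nonneg _) zero_le_one
        _ = 1 := one_mul _)
    intervalIntegrable_const
    (Filter.Eventually.of_forall fun t _ y _ => hasDerivAt_gegenbauerKernel n y t)
  exact h.2

/-- `it · e^{ixt} P_0(t) = i · e^{ixt} P_1(t)` (`P_0 = 1`, `P_1 = t`). [folklore] -/
private theorem I_mul_mul_gegenbauerKernel_zero (x t : ℝ) :
    I * t * gegenbauerKernel 0 x t = I * gegenbauerKernel 1 x t := by
  simp [gegenbauerKernel, legendre_zero, legendre_one]
  ring

/-- Bonnet's recursion inside the kernel:
`it · e^{ixt} P_{n+1}(t) = i/(2n+3) · ((n+2) e^{ixt} P_{n+2}(t) + (n+1) e^{ixt} P_n(t))`. [folklore] -/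
private theorem I_mul_mul_gegenbauerKernel_succ (n : ℕ) (x t : ℝ) :
    I * t * gegenbauerKernel (n + 1) x t =
      I / (2 * n + 3) * ((n + 2) * gegenbauerKernel (n + 2) x t + (n + 1) * gegenbauerKernel n x t) := by
  have hb := eval_legendre_add_two n t
  have h23 : (2 * (n : ℂ) + 3) ≠ 0 := by exact_mod_cast (by omega : 2 * n + 3 ≠ 0)
  have hb' : ((((n : ℝ) + 2) * (legendre (n + 2)).eval t : ℝ) : ℂ) =
      (((2 * (n : ℝ) + 3) * t * (legendre (n + 1)).eval t - ((n : ℝ) + 1) * (legendre n).eval t :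
        ℝ) : ℂ) := by
    exact_mod_cast hb
  push_cast at hb'
  simp only [gegenbauerKernel]
  rw [div_mul_eq_mul_div, eq_div_iff h23]
  linear_combination (-(I * cexp (I * x * t))) * hb'

/-- `G_0'(x) = i G_1(x)`. [folklore] -/
private theorem hasDerivAt_gegenbauerIntegral_zero (x : ℝ) :
    HasDerivAt (gegenbauerIntegral 0) (I * gegenbauerIntegral 1 x) x := by
  have h := hasDerivAt_gegenbauerIntegral 0 x
  simp_rw [I_mul_mul_gegenbauerKernel_zero, intervalIntegral.integral_const_mul] at h
  exact h

/-- `G_{n+1}'(x) = i/(2n+3) · ((n+2) G_{n+2}(x) + (n+1) G_n(x))`. [folklore] -/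
private theorem hasDerivAt_gegenbauerIntegral_succ (n : ℕ) (x : ℝ) :
    HasDerivAt (gegenbauerIntegral (n + 1))
      (I / (2 * n + 3) * ((n + 2) * gegenbauerIntegral (n + 2) x +
        (n + 1) * gegenbauerIntegral n x)) x := by
  have h := hasDerivAt_gegenbauerIntegral (n + 1) x
  simp_rw [I_mul_mul_gegenbauerKernel_succ, intervalIntegral.integral_const_mul] at h
  rw [intervalIntegral.integral_add ((intervalIntegrable_gegenbauerKernel _ _ _ _).const_mul _)
    ((intervalIntegrable_gegenbauerKernel _ _ _ _).const_mul _),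
    intervalIntegral.integral_const_mul, intervalIntegral.integral_const_mul] at h
  exact h

/-- The derivative `j_n'(x)` in closed form: `j_0' = -j_1` and
`j_{n+1}' = ((n+1) j_n - (n+2) j_{n+2}) / (2n+3)`. [cite: AbramowitzStegun1964, 10.1.20] -/
noncomputable def sphBesselJDeriv : ℕ → ℝ → ℝ
  | 0, x => -sphBesselJ 1 x
  | n + 1, x => (((n : ℝ) + 1) * sphBesselJ n x - ((n : ℝ) + 2) * sphBesselJ (n + 2) x) / (2 * n + 3)

/-- `j_0' = -j_1` (unfolding). [cite: AbramowitzStegun1964, 10.1.20] -/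
theorem sphBesselJDeriv_zero (x : ℝ) : sphBesselJDeriv 0 x = -sphBesselJ 1 x := rfl

/-- `j_{n+1}' = ((n+1) j_n - (n+2) j_{n+2})/(2n+3)` (unfolding). [cite: AbramowitzStegun1964, 10.1.20] -/
theorem sphBesselJDeriv_succ (n : ℕ) (x : ℝ) :
    sphBesselJDeriv (n + 1) x =
      (((n : ℝ) + 1) * sphBesselJ n x - ((n : ℝ) + 2) * sphBesselJ (n + 2) x) / (2 * n + 3) := rfl

/-- `j_n = re ∘ (x ↦ ½(-i)ⁿ G_n(x))` is differentiable with the obvious derivative. [folklore] -/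
private theorem hasDerivAt_sphBesselJ_re {n : ℕ} {x : ℝ} {G' : ℂ}
    (hG : HasDerivAt (gegenbauerIntegral n) G' x) :
    HasDerivAt (sphBesselJ n) (((-I) ^ n / 2 * G').re) x := by
  have h1 := hG.const_mul ((-I) ^ n / 2)
  have h2 := (Complex.reCLM.hasFDerivAt.comp_hasDerivAt x h1)
  have hf : (⇑Complex.reCLM ∘ fun y => (-I) ^ n / 2 * gegenbauerIntegral n y) = sphBesselJ n := by
    funext y; simp [sphBesselJ]
  rw [hf] at h2
  simpa using h2

/-- **`j_0'(x) = -j_1(x)`**. [cite: AbramowitzStegun1964, 10.1.20 (n = 0), 10.1.22] -/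
theorem hasDerivAt_sphBesselJ_zero (x : ℝ) :
    HasDerivAt (sphBesselJ 0) (-sphBesselJ 1 x) x := by
  have h := hasDerivAt_sphBesselJ_re (hasDerivAt_gegenbauerIntegral_zero x)
  convert h using 1
  rw [← ofReal_re (-sphBesselJ 1 x)]
  congr 1
  push_cast
  rw [ofReal_sphBesselJ]
  ring

/-- **`(2n+3) j_{n+1}'(x) = (n+1) j_n(x) - (n+2) j_{n+2}(x)`**.
[cite: AbramowitzStegun1964, 10.1.20] -/
theorem hasDerivAt_sphBesselJ_succ (n : ℕ) (x : ℝ) :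
    HasDerivAt (sphBesselJ (n + 1))
      ((((n : ℝ) + 1) * sphBesselJ n x - ((n : ℝ) + 2) * sphBesselJ (n + 2) x) / (2 * n + 3)) x := by
  have h := hasDerivAt_sphBesselJ_re (hasDerivAt_gegenbauerIntegral_succ n x)
  convert h using 1
  rw [← ofReal_re ((((n : ℝ) + 1) * sphBesselJ n x - ((n : ℝ) + 2) * sphBesselJ (n + 2) x) /
    (2 * n + 3))]
  congr 1
  push_cast
  rw [ofReal_sphBesselJ, ofReal_sphBesselJ]
  simp only [pow_succ]
  linear_combination (((n : ℂ) + 1) * (-I) ^ n * gegenbauerIntegral n x / 2 / (2 * n + 3)) * I_sq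

/-- **The derivative of `j_n`**: `HasDerivAt (j_n) (j_n'(x)) x` with `j_n'` as in
`sphBesselJDeriv`. [cite: AbramowitzStegun1964, 10.1.20] -/
theorem hasDerivAt_sphBesselJ (n : ℕ) (x : ℝ) :
    HasDerivAt (sphBesselJ n) (sphBesselJDeriv n x) x := by
  cases n with
  | zero => exact hasDerivAt_sphBesselJ_zero x
  | succ n => exact hasDerivAt_sphBesselJ_succ n x

/-- `deriv j_n = j_n'` in closed form. [cite: AbramowitzStegun1964, 10.1.20] -/
theorem deriv_sphBesselJ (n : ℕ) (x : ℝ) : deriv (sphBesselJ n) x = sphBesselJDeriv n x :=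
  (hasDerivAt_sphBesselJ n x).deriv

/-- `j_n` is differentiable on `ℝ`. [cite: AbramowitzStegun1964, 10.1.20] -/
theorem differentiable_sphBesselJ (n : ℕ) : Differentiable ℝ (sphBesselJ n) :=
  fun x => (hasDerivAt_sphBesselJ n x).differentiableAt

/-- `j_n` is continuous. [cite: AbramowitzStegun1964, 10.1.20] -/
theorem continuous_sphBesselJ (n : ℕ) : Continuous (sphBesselJ n) :=
  (differentiable_sphBesselJ n).continuous

/-- **`|j_n'(x)| ≤ 1`** for real `x` (from `|j_m| ≤ 1` and the differentiation formula: the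
coefficients `(n+1)/(2n+3)`, `(n+2)/(2n+3)` sum to `1`).  This is the derivative bound behind the
program's mean-value form. [cite: AbramowitzStegun1964, 10.1.20 with 10.1.50] -/
theorem abs_sphBesselJDeriv_le_one (n : ℕ) (x : ℝ) : |sphBesselJDeriv n x| ≤ 1 := by
  cases n with
  | zero => rw [sphBesselJDeriv_zero, abs_neg]; exact abs_sphBesselJ_le_one 1 x
  | succ n =>
    rw [sphBesselJDeriv_succ, abs_div, abs_of_pos (by positivity : (0 : ℝ) < 2 * n + 3),
      div_le_one (by positivity)]
    have h1 := abs_sphBesselJ_le_one n x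
    have h2 := abs_sphBesselJ_le_one (n + 2) x
    calc |((n : ℝ) + 1) * sphBesselJ n x - ((n : ℝ) + 2) * sphBesselJ (n + 2) x|
        ≤ |((n : ℝ) + 1) * sphBesselJ n x| + |((n : ℝ) + 2) * sphBesselJ (n + 2) x| := abs_sub _ _
      _ = ((n : ℝ) + 1) * |sphBesselJ n x| + ((n : ℝ) + 2) * |sphBesselJ (n + 2) x| := by
          rw [abs_mul, abs_mul, abs_of_nonneg (by positivity : (0 : ℝ) ≤ n + 1),
            abs_of_nonneg (by positivity : (0 : ℝ) ≤ n + 2)]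
      _ ≤ ((n : ℝ) + 1) * 1 + ((n : ℝ) + 2) * 1 := by gcongr
      _ = 2 * n + 3 := by ring

/-- `|deriv j_n (x)| ≤ 1` for real `x`. [cite: AbramowitzStegun1964, 10.1.20] [cite: DLMF, 10.51.2] -/
theorem abs_deriv_sphBesselJ_le_one (n : ℕ) (x : ℝ) : |deriv (sphBesselJ n) x| ≤ 1 := by
  rw [deriv_sphBesselJ]; exact abs_sphBesselJDeriv_le_one n x

/-- **`j_n` is `1`-Lipschitz on `ℝ`**. [cite: AbramowitzStegun1964, 10.1.20 with 10.1.50] -/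
theorem lipschitzWith_sphBesselJ (n : ℕ) : LipschitzWith 1 (sphBesselJ n) :=
  lipschitzWith_of_nnnorm_deriv_le (differentiable_sphBesselJ n) fun x => by
    rw [← NNReal.coe_le_coe, coe_nnnorm, Real.norm_eq_abs, NNReal.coe_one]
    exact abs_deriv_sphBesselJ_le_one n x

/-- **The mean-value enclosure** used by the program: `|j_n(t) - j_n(m)| ≤ |t - m|`, so that
`j_n(t) ∈ [j_n(m) - r, j_n(m) + r]` whenever `|t - m| ≤ r`.
[cite: AbramowitzStegun1964, 10.1.20 with 10.1.50] -/
theorem abs_sphBesselJ_sub_le (n : ℕ) (t m : ℝ) : |sphBesselJ n t - sphBesselJ n m| ≤ |t - m| := by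
  have h := (lipschitzWith_sphBesselJ n).dist_le_mul t m
  simpa [Real.dist_eq] using h

/-- The program's mean-value enclosure: `|t - m| ≤ r ⇒ j_n(t) ∈ [j_n(m) - r, j_n(m) + r]`.
[cite: AbramowitzStegun1964, 10.1.20] [cite: DLMF, 10.51.2] -/
theorem sphBesselJ_mem_Icc_of_abs_sub_le (n : ℕ) {t m r : ℝ} (h : |t - m| ≤ r) :
    sphBesselJ n t ∈ Icc (sphBesselJ n m - r) (sphBesselJ n m + r) := by
  have h' := (abs_sphBesselJ_sub_le n t m).trans h
  rw [abs_le] at h'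
  constructor <;> linarith [h'.1, h'.2]

/-- A&S 10.1.21 for `j`: `j_{n+1}'(x) = j_n(x) - (n+2) x⁻¹ j_{n+1}(x)` (`x ≠ 0`).
[cite: AbramowitzStegun1964, 10.1.21] -/
theorem sphBesselJDeriv_succ_eq_sub {x : ℝ} (hx : x ≠ 0) (n : ℕ) :
    sphBesselJDeriv (n + 1) x = sphBesselJ n x - (n + 2) / x * sphBesselJ (n + 1) x := by
  have h23 : (2 * (n : ℝ) + 3) ≠ 0 := by positivity
  rw [sphBesselJDeriv_succ, sphBesselJ_add_two hx n]
  field_simp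
  ring

/-- A&S 10.1.22 for `j`: `j_{n+1}'(x) = n x⁻¹... ` precisely `j_n'(x) = n x⁻¹ j_n(x) - j_{n+1}(x)`,
here for the index `n + 1`: `j_{n+1}'(x) = (n+1) x⁻¹ j_{n+1}(x) - j_{n+2}(x)` (`x ≠ 0`; for the index
`0` it is `sphBesselJDeriv_zero`). [cite: AbramowitzStegun1964, 10.1.22] -/
theorem sphBesselJDeriv_succ_eq_sub' {x : ℝ} (hx : x ≠ 0) (n : ℕ) :
    sphBesselJDeriv (n + 1) x = (n + 1) / x * sphBesselJ (n + 1) x - sphBesselJ (n + 2) x := by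
  rw [sphBesselJDeriv_succ_eq_sub hx, sphBesselJ_add_two hx n]
  ring

/-! ### `j_1` and the finite trigonometric (Rayleigh) form -/

/-- **`j_1(x) = sin x / x² - cos x / x`** (`x ≠ 0`), from `j_1 = -j_0'` and `j_0 = sin x / x`
near `x`. [cite: AbramowitzStegun1964, 10.1.11] -/
theorem sphBesselJ_one_left {x : ℝ} (hx : x ≠ 0) :
    sphBesselJ 1 x = Real.sin x / x ^ 2 - Real.cos x / x := by
  -- `j_0 = sin / id` on the open set `{x ≠ 0}`, so the derivatives there agree
  have hd : HasDerivAt (fun y : ℝ => Real.sin y / y)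
      ((Real.cos x * x - Real.sin x * 1) / x ^ 2) x :=
    (Real.hasDerivAt_sin x).div (hasDerivAt_id x) hx
  have heq : (fun y : ℝ => Real.sin y / y) =ᶠ[𝓝 x] sphBesselJ 0 := by
    filter_upwards [isOpen_ne.mem_nhds hx] with y hy
    exact (sphBesselJ_zero_left hy).symm
  have h1 := (hd.congr_of_eventuallyEq heq.symm).unique (hasDerivAt_sphBesselJ_zero x)
  field_simp
  field_simp at h1
  linear_combination h1

/-- **Rayleigh's polynomials**: the integer polynomial sequences `A_l`, `B_l` (in `t = 1/x`)
with `A_0 = t`, `A_1 = t²`, `B_0 = 0`, `B_1 = -t` and `C_{l+2} = (2l+3) t C_{l+1} - C_l`, so that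
`j_l(x) = A_l(1/x) sin x + B_l(1/x) cos x` (`sphBesselJ_eq_rayleigh`).  This is the program's
`rayleigh_polys`. [cite: AbramowitzStegun1964, 10.1.10–10.1.11 with 10.1.19] -/
noncomputable def rayleighA : ℕ → ℤ[X]
  | 0 => X
  | 1 => X ^ 2
  | l + 2 => C (2 * (l : ℤ) + 3) * X * rayleighA (l + 1) - rayleighA l

/-- See `rayleighA`. [cite: AbramowitzStegun1964, 10.1.10–10.1.11 with 10.1.19] -/
noncomputable def rayleighB : ℕ → ℤ[X]
  | 0 => 0
  | 1 => -X
  | l + 2 => C (2 * (l : ℤ) + 3) * X * rayleighB (l + 1) - rayleighB l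

/-- `A_0 = t`. [cite: AbramowitzStegun1964, 10.1.11] -/
@[simp] theorem rayleighA_zero : rayleighA 0 = X := rfl
/-- `A_1 = t²`. [cite: AbramowitzStegun1964, 10.1.11] -/
@[simp] theorem rayleighA_one : rayleighA 1 = X ^ 2 := rfl
/-- `A_{l+2} = (2l+3) t A_{l+1} - A_l`. [cite: AbramowitzStegun1964, 10.1.10 with 10.1.19] -/
theorem rayleighA_add_two (l : ℕ) :
    rayleighA (l + 2) = C (2 * (l : ℤ) + 3) * X * rayleighA (l + 1) - rayleighA l := rfl
/-- `B_0 = 0`. [cite: AbramowitzStegun1964, 10.1.11] -/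
@[simp] theorem rayleighB_zero : rayleighB 0 = 0 := rfl
/-- `B_1 = -t`. [cite: AbramowitzStegun1964, 10.1.11] -/
@[simp] theorem rayleighB_one : rayleighB 1 = -X := rfl
/-- `B_{l+2} = (2l+3) t B_{l+1} - B_l`. [cite: AbramowitzStegun1964, 10.1.10 with 10.1.19] -/
theorem rayleighB_add_two (l : ℕ) :
    rayleighB (l + 2) = C (2 * (l : ℤ) + 3) * X * rayleighB (l + 1) - rayleighB l := rfl

/-- **The finite trigonometric form `j_l(x) = A_l(1/x) sin x + B_l(1/x) cos x`** (`x ≠ 0`) with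
Rayleigh's integer polynomials; e.g. `j_2(x) = (3/x³ - 1/x) sin x - (3/x²) cos x`.
[cite: AbramowitzStegun1964, 10.1.10–10.1.11 with 10.1.19] -/
theorem sphBesselJ_eq_rayleigh {x : ℝ} (hx : x ≠ 0) (l : ℕ) :
    sphBesselJ l x = aeval x⁻¹ (rayleighA l) * Real.sin x + aeval x⁻¹ (rayleighB l) * Real.cos x := by
  -- two-step induction, carried as a conjunction
  suffices h : ∀ l, (sphBesselJ l x = aeval x⁻¹ (rayleighA l) * Real.sin x +
        aeval x⁻¹ (rayleighB l) * Real.cos x) ∧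
      (sphBesselJ (l + 1) x = aeval x⁻¹ (rayleighA (l + 1)) * Real.sin x +
        aeval x⁻¹ (rayleighB (l + 1)) * Real.cos x) from (h l).1
  intro l
  induction l with
  | zero =>
    refine ⟨?_, ?_⟩
    · rw [sphBesselJ_zero_left hx]; simp [div_eq_mul_inv, mul_comm]
    · rw [sphBesselJ_one_left hx]; simp; ring
  | succ l ih =>
    refine ⟨ih.2, ?_⟩
    rw [show l + 1 + 1 = l + 2 from rfl, sphBesselJ_add_two hx l, ih.1, ih.2, rayleighA_add_two,
      rayleighB_add_two]
    simp only [map_sub, map_mul, aeval_C, aeval_X]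
    simp only [eq_intCast]
    push_cast
    ring

/-- `j_2(x) = (3/x³ - 1/x) sin x - (3/x²) cos x` (`x ≠ 0`). [cite: AbramowitzStegun1964, 10.1.11] -/
theorem sphBesselJ_two_left {x : ℝ} (hx : x ≠ 0) :
    sphBesselJ 2 x = (3 / x ^ 3 - 1 / x) * Real.sin x - 3 / x ^ 2 * Real.cos x := by
  rw [sphBesselJ_eq_rayleigh hx 2, rayleighA_add_two, rayleighB_add_two, rayleighA_zero,
    rayleighA_one, rayleighB_zero, rayleighB_one]
  simp only [map_sub, map_mul, map_neg, map_zero, map_pow, aeval_C, aeval_X]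
  simp only [eq_intCast]
  push_cast
  field_simp
  ring

/-! ### The ascending series (A&S 10.1.2) -/

/-- The kernel expanded: `e^{ixt} P_n(t) = Σ_m (ixt)^m / m! · P_n(t)`. [folklore] -/
private theorem hasSum_gegenbauerKernel (n : ℕ) (x t : ℝ) :
    HasSum (fun m : ℕ => (I * x * t) ^ m / m ! * (((legendre n).eval t : ℝ) : ℂ))
      (gegenbauerKernel n x t) := by
  have h := (NormedSpace.expSeries_div_hasSum_exp (I * (x : ℂ) * t)).mul_right
    (((legendre n).eval t : ℝ) : ℂ)
  rwa [← congr_fun Complex.exp_eq_exp_ℂ (I * x * t)] at h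

/-- The moments `μ_{m,n} = ∫_{-1}^1 t^m P_n(t) dt` (the coefficients of Gegenbauer's integral expanded in
powers of `ix`). [cite: AbramowitzStegun1964, 10.1.14 with 10.1.2] -/
noncomputable def legendreMoment (m n : ℕ) : ℝ :=
  ∫ t in (-1 : ℝ)..1, t ^ m * (legendre n).eval t

/-- `∫_{-1}^1 (ixt)^m/m! P_n(t) dt = (ix)^m/m! · μ_{m,n}`. [folklore] -/
private theorem integral_expTerm (n m : ℕ) (x : ℝ) :
    ∫ t in (-1 : ℝ)..1, (I * x * t) ^ m / m ! * (((legendre n).eval t : ℝ) : ℂ) =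
      (I * x) ^ m / m ! * (legendreMoment m n : ℂ) := by
  have h : ∀ t : ℝ, (I * x * t) ^ m / m ! * (((legendre n).eval t : ℝ) : ℂ) =
      (I * x) ^ m / m ! * ((t ^ m * (legendre n).eval t : ℝ) : ℂ) := by
    intro t; push_cast; ring
  simp_rw [h, intervalIntegral.integral_const_mul, intervalIntegral.integral_ofReal, legendreMoment]

/-- **Term-by-term integration of the exponential series** (dominated convergence with the
summable bound `|x|^m / m!`): `G_n(x) = Σ_m (ix)^m/m! · μ_{m,n}`. [cite: AbramowitzStegun1964, 10.1.14 with 10.1.2] -/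
theorem hasSum_gegenbauerIntegral (n : ℕ) (x : ℝ) :
    HasSum (fun m : ℕ => (I * x) ^ m / m ! * (legendreMoment m n : ℂ)) (gegenbauerIntegral n x) := by
  have h := intervalIntegral.hasSum_integral_of_dominated_convergence (μ := volume)
    (a := (-1 : ℝ)) (b := 1)
    (F := fun m t => (I * x * t) ^ m / m ! * (((legendre n).eval t : ℝ) : ℂ))
    (f := gegenbauerKernel n x) (fun m _ => |x| ^ m / m !)
    (fun m => (by fun_prop : Continuous fun t : ℝ =>
      (I * x * t) ^ m / m ! * (((legendre n).eval t : ℝ) : ℂ)).aestronglyMeasurable)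
    (fun m => Filter.Eventually.of_forall fun t ht => by
      rw [uIoc_of_le (by norm_num)] at ht
      have ht' : |t| ≤ 1 := abs_le.mpr ⟨ht.1.le, ht.2⟩
      simp only [norm_mul, norm_div, norm_pow, norm_I, one_mul, norm_real, Real.norm_eq_abs,
        norm_natCast]
      have h1 : (|x| * |t|) ^ m ≤ |x| ^ m := by
        apply pow_le_pow_left₀ (by positivity)
        calc |x| * |t| ≤ |x| * 1 := by gcongr
          _ = |x| := mul_one _
      have h2 := abs_eval_legendre_le_one n ht'
      calc (|x| * |t|) ^ m / m ! * |(legendre n).eval t| ≤ |x| ^ m / m ! * 1 := by gcongr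
        _ = |x| ^ m / m ! := mul_one _)
    (Filter.Eventually.of_forall fun t _ => Real.summable_pow_div_factorial |x|)
    intervalIntegrable_const
    (Filter.Eventually.of_forall fun t _ => hasSum_gegenbauerKernel n x t)
  simp_rw [integral_expTerm] at h
  exact h

/-- `μ_{m,n} = 0` for `m < n` (orthogonality of `P_n` to lower-degree polynomials).
[cite: AndrewsAskeyRoy1999, (2.5.14) (α = β = 0)] -/
theorem legendreMoment_eq_zero_of_lt {m n : ℕ} (h : m < n) : legendreMoment m n = 0 := by
  have h' := integral_legendre_mul_eq_zero (n := n) (q := X ^ m)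
    (by rw [degree_X_pow]; exact_mod_cast h)
  simp only [eval_pow, eval_X] at h'
  unfold legendreMoment
  rw [← h']
  exact intervalIntegral.integral_congr fun t _ => mul_comm _ _

/-- `μ_{m,n} = 0` when `m + n` is odd (parity `P_n(-t) = (-1)ⁿ P_n(t)`). [cite: Arfken1985, (12.37)] -/
theorem legendreMoment_eq_zero_of_odd {m n : ℕ} (h : Odd (m + n)) : legendreMoment m n = 0 := by
  have h1 := intervalIntegral.integral_comp_neg (a := (-1 : ℝ)) (b := 1)
    (fun t : ℝ => t ^ m * (legendre n).eval t)
  simp only [neg_neg] at h1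
  have h2 : ∀ t : ℝ, (-t) ^ m * (legendre n).eval (-t) = -(t ^ m * (legendre n).eval t) := by
    intro t
    rw [eval_neg_legendre, neg_pow, show (-1 : ℝ) ^ m * t ^ m * ((-1) ^ n * (legendre n).eval t) =
      (-1) ^ (m + n) * (t ^ m * (legendre n).eval t) by ring, h.neg_one_pow]
    ring
  simp_rw [h2, intervalIntegral.integral_neg] at h1
  unfold legendreMoment
  linarith

/-- `I(k, n) = ∫_{-1}^1 t^{2k} (1 - t²)ⁿ dt` (a Beta integral). [folklore] -/
private noncomputable def evenMoment (k n : ℕ) : ℝ := ∫ t in (-1 : ℝ)..1, t ^ (2 * k) * (1 - t ^ 2) ^ n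

/-- `I(k, 0) = 2 / (2k+1)`. [folklore] -/
private theorem evenMoment_zero_right (k : ℕ) : evenMoment k 0 = 2 / (2 * k + 1) := by
  unfold evenMoment
  simp only [pow_zero, mul_one]
  have h1 : ((-1 : ℝ)) ^ (2 * k + 1) = -1 := by rw [pow_succ, pow_mul]; norm_num
  rw [integral_pow, one_pow, h1]
  push_cast
  ring

/-- The Beta recursion `(2k+1) I(k, n+1) = 2(n+1) I(k+1, n)` (integration by parts).
[folklore] -/
private theorem evenMoment_succ_right (k n : ℕ) :
    (2 * k + 1) * evenMoment k (n + 1) = 2 * (n + 1) * evenMoment (k + 1) n := by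
  have h := integral_derivative_mul (X ^ (2 * k + 1)) ((1 - X ^ 2) ^ (n + 1))
  have hb1 : ((1 - X ^ 2) ^ (n + 1) : ℝ[X]).eval 1 = 0 := by simp
  have hb2 : ((1 - X ^ 2) ^ (n + 1) : ℝ[X]).eval (-1) = 0 := by simp
  rw [hb1, hb2, mul_zero, mul_zero, sub_zero, zero_sub] at h
  have hf : ∀ t : ℝ, (derivative (X ^ (2 * k + 1) : ℝ[X])).eval t *
      ((1 - X ^ 2) ^ (n + 1) : ℝ[X]).eval t =
        (2 * k + 1 : ℝ) * (t ^ (2 * k) * (1 - t ^ 2) ^ (n + 1)) := by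
    intro t
    rw [derivative_X_pow, Nat.add_sub_cancel]
    simp only [eval_mul, eval_C, eval_pow, eval_X, eval_sub, eval_one]
    push_cast; ring
  have hg : ∀ t : ℝ, (X ^ (2 * k + 1) : ℝ[X]).eval t *
      (derivative ((1 - X ^ 2) ^ (n + 1) : ℝ[X])).eval t =
        -(2 * (n + 1) : ℝ) * (t ^ (2 * (k + 1)) * (1 - t ^ 2) ^ n) := by
    intro t
    rw [derivative_pow_succ, derivative_sub, derivative_one, derivative_X_sq]
    simp only [eval_mul, eval_C, eval_pow, eval_X, eval_sub, eval_one, zero_sub, eval_neg]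
    ring
  simp_rw [hf, hg, intervalIntegral.integral_const_mul] at h
  unfold evenMoment
  linarith

/-- **The Beta integral in closed form**: `I(k, n) · 2ᵏ k! (2k+2n+1)!! = 2ⁿ⁺¹ n! (2k)!`, i.e.
`∫_{-1}^1 t^{2k}(1-t²)ⁿ dt = 2ⁿ⁺¹ n! (2k-1)!! / (2k+2n+1)!!`. [folklore] -/
private theorem evenMoment_mul (k n : ℕ) :
    evenMoment k n * (2 ^ k * k ! * (2 * k + 2 * n + 1)‼) = 2 ^ (n + 1) * n ! * (2 * k)! := by
  induction n generalizing k with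
  | zero =>
    have h1 : ((2 * k + 1)‼ : ℝ) * (2 ^ k * k !) = (2 * k + 1) * (2 * k)! := by
      norm_cast
      rw [← Nat.doubleFactorial_two_mul, ← Nat.factorial_eq_mul_doubleFactorial, Nat.factorial_succ]
    have h2k : (2 * (k : ℝ) + 1) ≠ 0 := by positivity
    rw [evenMoment_zero_right, Nat.mul_zero, Nat.add_zero, Nat.factorial_zero, zero_add, pow_one,
      Nat.cast_one, mul_one, div_mul_eq_mul_div, div_eq_iff h2k]
    linear_combination 2 * h1
  | succ n ih =>
    have hB := evenMoment_succ_right k n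
    have ih' := ih (k + 1)
    rw [show 2 * (k + 1) + 2 * n + 1 = 2 * k + 2 * (n + 1) + 1 by ring] at ih'
    have e1 : ((2 * (k + 1))! : ℝ) = (2 * k + 2) * (2 * k + 1) * (2 * k)! := by
      rw [show 2 * (k + 1) = (2 * k + 1) + 1 by ring, Nat.factorial_succ, Nat.factorial_succ]
      push_cast; ring
    have e2 : ((k + 1)! : ℝ) = (k + 1) * k ! := by rw [Nat.factorial_succ]; push_cast; ring
    have e3 : ((n + 1)! : ℝ) = (n + 1) * n ! := by rw [Nat.factorial_succ]; push_cast; ring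
    rw [e1, e2, pow_succ] at ih'
    rw [e3, pow_succ]
    have hne : ((2 * k + 1) * (k + 1) : ℝ) ≠ 0 := by positivity
    have key : ((2 * k + 1) * (k + 1) : ℝ) *
        (evenMoment k (n + 1) * (2 ^ k * k ! * (2 * k + 2 * (n + 1) + 1)‼) -
          2 ^ (n + 1) * 2 * ((n + 1) * n !) * (2 * k)!) = 0 := by
      linear_combination ((k + 1 : ℝ) * 2 ^ k * k ! * (2 * k + 2 * (n + 1) + 1)‼) * hB +
        ((n : ℝ) + 1) * ih'
    have h0 := (mul_eq_zero.mp key).resolve_left hne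
    linarith

/-- **The even moments of `P_n`**: `μ_{n+2k,n} · 2ᵏ k! (2n+2k+1)!! = 2 (n+2k)!`, i.e.
`∫_{-1}^1 t^{n+2k} P_n(t) dt = 2 (n+2k)! / (2ᵏ k! (2n+2k+1)!!)` (Rodrigues' formula and `n`-fold
integration by parts, then the Beta integral) — the identity that matches the `m = n + 2k`
coefficient of Gegenbauer's integral 10.1.14 with the `k`-th term of the ascending series 10.1.2.
[cite: AbramowitzStegun1964, 10.1.2 with 10.1.14] -/
theorem legendreMoment_add_two_mul (n k : ℕ) :
    legendreMoment (n + 2 * k) n * (2 ^ k * k ! * (2 * n + 2 * k + 1)‼) = 2 * (n + 2 * k)! := by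
  have hparts := integral_iterate_derivative_legendreW_mul n (j := n) le_rfl (X ^ (n + 2 * k))
  rw [Nat.sub_self, Function.iterate_zero_apply, iterate_derivative_X_pow_eq_C_mul,
    Nat.add_sub_cancel_left] at hparts
  have hW : ∀ t : ℝ, (legendreW n).eval t *
      (C (((n + 2 * k).descFactorial n : ℕ) : ℝ) * X ^ (2 * k) : ℝ[X]).eval t =
        ((-1) ^ n * ((n + 2 * k).descFactorial n : ℕ) : ℝ) * (t ^ (2 * k) * (1 - t ^ 2) ^ n) := by
    intro t
    simp only [legendreW, eval_mul, eval_C, eval_pow, eval_sub, eval_X, eval_one]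
    rw [show (t ^ 2 - 1 : ℝ) = (-1) * (1 - t ^ 2) by ring, mul_pow]
    ring
  simp_rw [hW, intervalIntegral.integral_const_mul] at hparts
  have hμ : legendreMoment (n + 2 * k) n = 1 / (2 ^ n * n !) *
      ∫ t in (-1 : ℝ)..1, (derivative^[n] (legendreW n)).eval t * (X ^ (n + 2 * k) : ℝ[X]).eval t := by
    unfold legendreMoment legendre
    rw [← intervalIntegral.integral_const_mul]
    refine intervalIntegral.integral_congr fun t _ => ?_
    simp only [eval_mul, eval_C, eval_pow, eval_X]
    ring
  have hI := evenMoment_mul k n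
  unfold evenMoment at hI
  rw [show 2 * k + 2 * n + 1 = 2 * n + 2 * k + 1 by ring] at hI
  have hc : ((((n + 2 * k).descFactorial n : ℕ) : ℝ)) * (2 * k)! = (n + 2 * k)! := by
    norm_cast
    have h := Nat.factorial_mul_descFactorial (n := n + 2 * k) (k := n) (by omega)
    rw [Nat.add_sub_cancel_left] at h
    rw [mul_comm]; exact h
  have hsq : ((-1 : ℝ) ^ n) * (-1) ^ n = 1 := by rw [← mul_pow]; norm_num
  have hn : (2 ^ n * n ! : ℝ) ≠ 0 := by positivity
  rw [hμ, hparts, div_mul_eq_mul_div, one_mul, div_mul_eq_mul_div, div_eq_iff hn]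
  linear_combination ((-1 : ℝ) ^ n * (-1) ^ n * (((n + 2 * k).descFactorial n : ℕ) : ℝ)) * hI +
    (2 ^ (n + 1) * n ! * (((n + 2 * k).descFactorial n : ℕ) : ℝ) * (2 * k)!) * hsq +
    (2 ^ (n + 1) * (n ! : ℝ)) * hc

/-- The `k`-th term of the ascending series of `j_n`:
`(-1)ᵏ x^{n+2k} / (2ᵏ k! (2n+2k+1)!!) = xⁿ/(2n+1)!! · (-x²/2)ᵏ / (k! (2n+3)(2n+5)⋯(2n+2k+1))`.
[cite: AbramowitzStegun1964, 10.1.2] [cite: DLMF, 10.53.1] -/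
noncomputable def sphBesselJTerm (n : ℕ) (x : ℝ) (k : ℕ) : ℝ :=
  (-1) ^ k * x ^ (n + 2 * k) / (2 ^ k * k ! * (2 * n + 2 * k + 1)‼)

/-- Unfolding the `k`-th term. [cite: AbramowitzStegun1964, 10.1.2] -/
theorem sphBesselJTerm_def (n : ℕ) (x : ℝ) (k : ℕ) :
    sphBesselJTerm n x k = (-1) ^ k * x ^ (n + 2 * k) / (2 ^ k * k ! * (2 * n + 2 * k + 1)‼) := rfl

/-- **The ascending series** `j_n(x) = Σ_{k ≥ 0} (-1)ᵏ x^{n+2k} / (2ᵏ k! (2n+2k+1)!!)`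
`= xⁿ/(1·3·5⋯(2n+1)) · {1 - (x²/2)/(1!(2n+3)) + (x²/2)²/(2!(2n+3)(2n+5)) - ⋯}` for every real `x`.
[cite: AbramowitzStegun1964, 10.1.2] [cite: DLMF, 10.53.1] -/
theorem hasSum_sphBesselJ (n : ℕ) (x : ℝ) : HasSum (sphBesselJTerm n x) (sphBesselJ n x) := by
  have h1 := hasSum_gegenbauerIntegral n x
  have hg : Function.Injective (fun k : ℕ => n + 2 * k) := by
    intro a b h; simp only at h; omega
  have hzero : ∀ m ∉ Set.range (fun k : ℕ => n + 2 * k),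
      (I * x) ^ m / m ! * (legendreMoment m n : ℂ) = 0 := by
    intro m hm
    rcases lt_or_ge m n with h | h
    · rw [legendreMoment_eq_zero_of_lt h]; simp
    · have hodd : Odd (m + n) := by
        rcases Nat.even_or_odd (m - n) with he | ho
        · exfalso; apply hm; obtain ⟨j, hj⟩ := he; exact ⟨j, by show n + 2 * j = m; omega⟩
        · obtain ⟨j, hj⟩ := ho; exact ⟨j + n, by omega⟩
      rw [legendreMoment_eq_zero_of_odd hodd]; simp
  have h2 := ((hg.hasSum_iff hzero).mpr h1).mul_left ((-I) ^ n / 2)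
  rw [← ofReal_sphBesselJ] at h2
  have hterm : ∀ k, (-I) ^ n / 2 * ((fun m : ℕ => (I * x) ^ m / m ! * (legendreMoment m n : ℂ)) ∘
      fun k : ℕ => n + 2 * k) k = (sphBesselJTerm n x k : ℂ) := by
    intro k
    have hμ := legendreMoment_add_two_mul n k
    have hA : (-I) ^ n / 2 * ((fun m : ℕ => (I * x) ^ m / m ! * (legendreMoment m n : ℂ)) ∘
        fun k : ℕ => n + 2 * k) k =
        ((-I) ^ n * I ^ (n + 2 * k)) * ((x : ℂ) ^ (n + 2 * k) * (legendreMoment (n + 2 * k) n : ℂ) /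
          (2 * ((n + 2 * k)! : ℂ))) := by
      simp only [Function.comp_apply, mul_pow]; ring
    have hIpow : (-I) ^ n * I ^ (n + 2 * k) = (-1) ^ k := by
      rw [pow_add, pow_mul, I_sq, ← mul_assoc, ← mul_pow, neg_mul, I_mul_I, neg_neg, one_pow,
        one_mul]
    have hreal : (-1 : ℝ) ^ k * (x ^ (n + 2 * k) * legendreMoment (n + 2 * k) n /
        (2 * (n + 2 * k)!)) = sphBesselJTerm n x k := by
      unfold sphBesselJTerm
      have h2m : (2 * ((n + 2 * k)! : ℝ)) ≠ 0 := by positivity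
      have hPD : (2 ^ k * k ! * (2 * n + 2 * k + 1)‼ : ℝ) ≠ 0 := by positivity
      rw [← mul_div_assoc, div_eq_div_iff h2m hPD]
      linear_combination ((-1 : ℝ) ^ k * x ^ (n + 2 * k)) * hμ
    rw [hA, hIpow, ← hreal]
    push_cast
    ring
  simp_rw [hterm] at h2
  exact Complex.hasSum_ofReal.mp h2

/-- The ascending series converges (absolutely) for every real `x`. [cite: AbramowitzStegun1964, 10.1.2] -/
theorem summable_sphBesselJTerm (n : ℕ) (x : ℝ) : Summable (sphBesselJTerm n x) :=
  (hasSum_sphBesselJ n x).summable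

/-- `j_n(x) = Σ'_k term_k`. [cite: AbramowitzStegun1964, 10.1.2] -/
theorem sphBesselJ_eq_tsum (n : ℕ) (x : ℝ) : sphBesselJ n x = ∑' k, sphBesselJTerm n x k :=
  (hasSum_sphBesselJ n x).tsum_eq.symm

/-- The terms are even/odd in `x` with `n`: `term_k(-x) = (-1)ⁿ term_k(x)`. [cite: AbramowitzStegun1964, 10.1.2] -/
theorem sphBesselJTerm_neg (n : ℕ) (x : ℝ) (k : ℕ) :
    sphBesselJTerm n (-x) k = (-1) ^ n * sphBesselJTerm n x k := by
  unfold sphBesselJTerm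
  rw [neg_pow x (n + 2 * k), pow_add (-1 : ℝ) n (2 * k), pow_mul (-1 : ℝ) 2 k, neg_one_sq, one_pow,
    mul_one]
  ring

/-- **Reflection** `j_n(-x) = (-1)ⁿ j_n(x)` (the program's sign rule for negative argument; immediate
from the ascending series). [cite: AbramowitzStegun1964, 10.1.2] [cite: DLMF, 10.47.14] -/
theorem sphBesselJ_neg (n : ℕ) (x : ℝ) : sphBesselJ n (-x) = (-1) ^ n * sphBesselJ n x := by
  have h1 := hasSum_sphBesselJ n (-x)
  have h2 := (hasSum_sphBesselJ n x).mul_left ((-1 : ℝ) ^ n)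
  have hfun : sphBesselJTerm n (-x) = fun k => (-1) ^ n * sphBesselJTerm n x k :=
    funext (sphBesselJTerm_neg n x)
  rw [hfun] at h1
  exact h1.unique h2

/-- `(2n+1)!! · (2n+3)(2n+5)⋯(2n+2k+1) = (2n+2k+1)!!`. [cite: AbramowitzStegun1964, 10.1.2] -/
theorem doubleFactorial_mul_prod_range (n k : ℕ) :
    (2 * n + 1)‼ * ∏ i ∈ Finset.range k, (2 * n + 2 * i + 3) = (2 * n + 2 * k + 1)‼ := by
  induction k with
  | zero => simp
  | succ k ih =>
    rw [Finset.prod_range_succ, ← mul_assoc, ih,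
      show 2 * n + 2 * (k + 1) + 1 = (2 * n + 2 * k + 1) + 2 by ring, Nat.doubleFactorial_add_two]
    ring

/-- The program's factorisation of the term: `term_k = xⁿ/(2n+1)!! · (-y)ᵏ/(k! ∏_{i<k}(2n+2i+3))`
with `y = x²/2`, so that `t_k = t_{k-1} · y / (k (2n+2k+1))`. [cite: DLMF, 10.53.1] -/
theorem sphBesselJTerm_eq_prefactor_mul (n : ℕ) (x : ℝ) (k : ℕ) :
    sphBesselJTerm n x k = x ^ n / (2 * n + 1)‼ *
      ((-(x ^ 2 / 2)) ^ k / (k ! * ∏ i ∈ Finset.range k, (2 * (n : ℝ) + 2 * i + 3))) := by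
  have h := congrArg (Nat.cast : ℕ → ℝ) (doubleFactorial_mul_prod_range n k)
  push_cast at h
  have hP : (0 : ℝ) < ∏ i ∈ Finset.range k, (2 * (n : ℝ) + 2 * i + 3) :=
    Finset.prod_pos fun i _ => by positivity
  unfold sphBesselJTerm
  rw [← h, neg_pow (x ^ 2 / 2) k, div_pow, ← pow_mul]
  field_simp
  ring

/-- The term ratio: `term_{k+1} = term_k · (-(x²/2)) / ((k+1)(2n+2k+3))`. [cite: DLMF, 10.53.1] -/
theorem sphBesselJTerm_succ (n : ℕ) (x : ℝ) (k : ℕ) :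
    sphBesselJTerm n x (k + 1) =
      sphBesselJTerm n x k * (-(x ^ 2 / 2) / ((k + 1) * (2 * n + 2 * k + 3))) := by
  unfold sphBesselJTerm
  rw [show 2 * n + 2 * (k + 1) + 1 = (2 * n + 2 * k + 1) + 2 by ring, Nat.doubleFactorial_add_two,
    Nat.factorial_succ, show n + 2 * (k + 1) = n + 2 * k + 2 by ring]
  have h1 : ((2 * n + 2 * k + 1)‼ : ℝ) ≠ 0 := by positivity
  have h2 : ((k ! : ℕ) : ℝ) ≠ 0 := by positivity
  have h3 : ((k : ℝ) + 1) ≠ 0 := by positivity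
  have h4 : (2 * (n : ℝ) + 2 * k + 3) ≠ 0 := by positivity
  have h5 : (((2 * n + 2 * k + 1 + 2 : ℕ) : ℝ)) ≠ 0 := by positivity
  push_cast
  field_simp
  ring

/-- `|term_{k+1}| = |term_k| · (x²/2) / ((k+1)(2n+2k+3))`. [cite: DLMF, 10.53.1] -/
theorem abs_sphBesselJTerm_succ (n : ℕ) (x : ℝ) (k : ℕ) :
    |sphBesselJTerm n x (k + 1)| =
      |sphBesselJTerm n x k| * (x ^ 2 / 2 / ((k + 1) * (2 * n + 2 * k + 3))) := by
  rw [sphBesselJTerm_succ, abs_mul, abs_div, abs_neg,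
    abs_of_nonneg (by positivity : (0 : ℝ) ≤ x ^ 2 / 2),
    abs_of_pos (by positivity : (0 : ℝ) < (k + 1) * (2 * n + 2 * k + 3))]

/-- The term ratios beyond `K` are bounded by `ρ ≥ (x²/2)/((K+1)(2n+2K+3))` (they decrease in `k`),
so `|term_{K+i}| ≤ |term_K| ρⁱ`. [cite: DLMF, 10.53.1] -/
theorem abs_sphBesselJTerm_add_le (n K : ℕ) {x ρ : ℝ}
    (hρ : x ^ 2 / 2 / ((K + 1) * (2 * n + 2 * K + 3)) ≤ ρ) (i : ℕ) :
    |sphBesselJTerm n x (K + i)| ≤ |sphBesselJTerm n x K| * ρ ^ i := by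
  have hρ0 : 0 ≤ ρ := le_trans (by positivity) hρ
  induction i with
  | zero => simp
  | succ i ih =>
    rw [← add_assoc, abs_sphBesselJTerm_succ, pow_succ ρ i, ← mul_assoc]
    have hr : x ^ 2 / 2 / ((((K + i : ℕ) : ℝ) + 1) * (2 * n + 2 * ((K + i : ℕ) : ℝ) + 3)) ≤ ρ := by
      refine le_trans ?_ hρ
      apply div_le_div_of_nonneg_left (by positivity) (by positivity)
      push_cast
      have hi : (0 : ℝ) ≤ i := Nat.cast_nonneg i
      have hK : (0 : ℝ) ≤ K := Nat.cast_nonneg K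
      have hn : (0 : ℝ) ≤ n := Nat.cast_nonneg n
      nlinarith [mul_nonneg hi hn, mul_nonneg hi hK, mul_nonneg hi hi]
    exact mul_le_mul ih hr (by positivity) (mul_nonneg (abs_nonneg _) (pow_nonneg hρ0 _))

/-- **The rigorous tail of the ascending series** (the program's stopping rule): if
`(x²/2) / ((K+1)(2n+2K+3)) ≤ ρ < 1` then
`|j_n(x) - Σ_{k ≤ K} term_k| ≤ |term_K| · ρ/(1-ρ)`, because every later term ratio is at most `ρ`.
[cite: AbramowitzStegun1964, 10.1.2] [cite: DLMF, 10.53.1] -/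
theorem abs_sphBesselJ_sub_sum_le (n K : ℕ) {x ρ : ℝ}
    (hρ : x ^ 2 / 2 / ((K + 1) * (2 * n + 2 * K + 3)) ≤ ρ) (hρ1 : ρ < 1) :
    |sphBesselJ n x - ∑ k ∈ Finset.range (K + 1), sphBesselJTerm n x k| ≤
      |sphBesselJTerm n x K| * (ρ / (1 - ρ)) := by
  have hρ0 : 0 ≤ ρ := le_trans (by positivity) hρ
  have hs := hasSum_sphBesselJ n x
  have hsplit := hs.summable.sum_add_tsum_nat_add (K + 1)
  rw [hs.tsum_eq] at hsplit
  have htail : sphBesselJ n x - ∑ k ∈ Finset.range (K + 1), sphBesselJTerm n x k =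
      ∑' i, sphBesselJTerm n x (i + (K + 1)) := by linarith
  rw [htail]
  have hbound : ∀ i, |sphBesselJTerm n x (i + (K + 1))| ≤ |sphBesselJTerm n x K| * ρ * ρ ^ i := by
    intro i
    have h := abs_sphBesselJTerm_add_le n K hρ (i + 1)
    rw [show K + (i + 1) = i + (K + 1) by ring, pow_succ] at h
    calc |sphBesselJTerm n x (i + (K + 1))| ≤ |sphBesselJTerm n x K| * (ρ ^ i * ρ) := h
      _ = |sphBesselJTerm n x K| * ρ * ρ ^ i := by ring
  have hgeom : Summable fun i : ℕ => |sphBesselJTerm n x K| * ρ * ρ ^ i :=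
    (summable_geometric_of_lt_one hρ0 hρ1).mul_left _
  have habs : Summable fun i : ℕ => |sphBesselJTerm n x (i + (K + 1))| :=
    Summable.of_nonneg_of_le (fun i => abs_nonneg _) hbound hgeom
  have hnorm : Summable fun i : ℕ => ‖sphBesselJTerm n x (i + (K + 1))‖ := by
    simpa only [Real.norm_eq_abs] using habs
  calc |∑' i, sphBesselJTerm n x (i + (K + 1))|
      ≤ ∑' i, |sphBesselJTerm n x (i + (K + 1))| := by
        have h := norm_tsum_le_tsum_norm hnorm
        simpa only [Real.norm_eq_abs] using h
    _ ≤ ∑' i, |sphBesselJTerm n x K| * ρ * ρ ^ i := Summable.tsum_le_tsum hbound habs hgeom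
    _ = |sphBesselJTerm n x K| * (ρ / (1 - ρ)) := by
        rw [tsum_mul_left, tsum_geometric_of_lt_one hρ0 hρ1]; ring

/-! ### The program's normalisation: `j_n = (xⁿ/(2n+1)!!) · S`, `S = Σ_k u_k` -/

/-- The program's reduced term `u_k = (-y)^k / (k! ∏_{i<k}(2n+2i+3))`, `y = x²/2` (`t_k` with its sign in
`_series_direct`), so that `term_k = (xⁿ/(2n+1)!!) u_k`. [cite: AbramowitzStegun1964, 10.1.2] -/
noncomputable def sphBesselJRedTerm (n : ℕ) (x : ℝ) (k : ℕ) : ℝ :=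
  (-(x ^ 2 / 2)) ^ k / (k ! * ∏ i ∈ Finset.range k, (2 * (n : ℝ) + 2 * i + 3))

/-- `term_k = (xⁿ/(2n+1)!!) · u_k`. [cite: AbramowitzStegun1964, 10.1.2] -/
theorem sphBesselJTerm_eq_prefactor_mul_redTerm (n : ℕ) (x : ℝ) (k : ℕ) :
    sphBesselJTerm n x k = x ^ n / (2 * n + 1)‼ * sphBesselJRedTerm n x k :=
  sphBesselJTerm_eq_prefactor_mul n x k

/-- `u_0 = 1`. [cite: AbramowitzStegun1964, 10.1.2] -/
@[simp] theorem sphBesselJRedTerm_zero (n : ℕ) (x : ℝ) : sphBesselJRedTerm n x 0 = 1 := by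
  simp [sphBesselJRedTerm]

/-- The program's update `t_{k+1} = t_k · y/((k+1)(2n+2k+3))` (with the alternating sign):
`u_{k+1} = u_k · (-(x²/2))/((k+1)(2n+2k+3))`. [cite: AbramowitzStegun1964, 10.1.2] [cite: DLMF, 10.53.1] -/
theorem sphBesselJRedTerm_succ (n : ℕ) (x : ℝ) (k : ℕ) :
    sphBesselJRedTerm n x (k + 1) =
      sphBesselJRedTerm n x k * (-(x ^ 2 / 2) / ((k + 1) * (2 * n + 2 * k + 3))) := by
  unfold sphBesselJRedTerm
  have hP : 0 < ∏ i ∈ Finset.range k, (2 * (n : ℝ) + 2 * i + 3) :=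
    Finset.prod_pos fun i _ => by positivity
  rw [Finset.prod_range_succ, Nat.factorial_succ, pow_succ]
  push_cast
  field_simp

/-- At `x = 0` only `u_0 = 1` survives. [cite: AbramowitzStegun1964, 10.1.2] -/
theorem sphBesselJRedTerm_zero_right (n k : ℕ) :
    sphBesselJRedTerm n 0 k = if k = 0 then 1 else 0 := by
  unfold sphBesselJRedTerm
  cases k <;> simp

/-- For `x ≠ 0` the reduced series sums to `j_n(x) / (xⁿ/(2n+1)!!)`. [cite: AbramowitzStegun1964, 10.1.2] -/
theorem hasSum_sphBesselJRedTerm {x : ℝ} (hx : x ≠ 0) (n : ℕ) :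
    HasSum (sphBesselJRedTerm n x) (sphBesselJ n x / (x ^ n / (2 * n + 1)‼)) := by
  have hp : (x ^ n / (2 * n + 1)‼ : ℝ) ≠ 0 := div_ne_zero (pow_ne_zero _ hx) (by positivity)
  have h := (hasSum_sphBesselJ n x).div_const (x ^ n / (2 * n + 1)‼)
  have hfun : (fun k => sphBesselJTerm n x k / (x ^ n / (2 * n + 1)‼)) = sphBesselJRedTerm n x := by
    funext k
    rw [sphBesselJTerm_eq_prefactor_mul_redTerm, mul_div_cancel_left₀ _ hp]
  rwa [hfun] at h

/-- The reduced series converges for every real `x`. [cite: AbramowitzStegun1964, 10.1.2] -/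
theorem summable_sphBesselJRedTerm (n : ℕ) (x : ℝ) : Summable (sphBesselJRedTerm n x) := by
  by_cases hx : x = 0
  · subst hx
    have hfun : sphBesselJRedTerm n 0 = fun k => if k = 0 then (1 : ℝ) else 0 :=
      funext (sphBesselJRedTerm_zero_right n)
    rw [hfun]
    exact (hasSum_ite_eq 0 (1 : ℝ)).summable
  · exact (hasSum_sphBesselJRedTerm hx n).summable

/-- **`j_n(x) = (xⁿ/(2n+1)!!) · Σ_k u_k`** for every real `x` (the program's `J = pref * S`).
[cite: AbramowitzStegun1964, 10.1.2] -/
theorem sphBesselJ_eq_prefactor_mul_tsum (n : ℕ) (x : ℝ) :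
    sphBesselJ n x = x ^ n / (2 * n + 1)‼ * ∑' k, sphBesselJRedTerm n x k := by
  by_cases hx : x = 0
  · subst hx
    rw [tsum_congr (sphBesselJRedTerm_zero_right n), tsum_ite_eq]
    cases n with
    | zero => simp [sphBesselJ_zero_zero]
    | succ n => simp [sphBesselJ_succ_zero]
  · have hp : (x ^ n / (2 * n + 1)‼ : ℝ) ≠ 0 := div_ne_zero (pow_ne_zero _ hx) (by positivity)
    rw [(hasSum_sphBesselJRedTerm hx n).tsum_eq, mul_div_cancel₀ _ hp]

/-- **The rigorous tail at the level of the reduced series** (exactly the program's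
`tail = t.hi · rho/(1 - rho)`): if `(x²/2)/((K+1)(2n+2K+3)) ≤ ρ < 1` then
`|S - Σ_{k≤K} u_k| ≤ |u_K| · ρ/(1-ρ)`. [cite: AbramowitzStegun1964, 10.1.2] [cite: DLMF, 10.53.1] -/
theorem abs_tsum_sphBesselJRedTerm_sub_sum_le (n K : ℕ) {x ρ : ℝ}
    (hρ : x ^ 2 / 2 / ((K + 1) * (2 * n + 2 * K + 3)) ≤ ρ) (hρ1 : ρ < 1) :
    |∑' k, sphBesselJRedTerm n x k - ∑ k ∈ Finset.range (K + 1), sphBesselJRedTerm n x k| ≤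
      |sphBesselJRedTerm n x K| * (ρ / (1 - ρ)) := by
  have hρ0 : 0 ≤ ρ := le_trans (by positivity) hρ
  by_cases hx : x = 0
  · subst hx
    have hS : ∑' k, sphBesselJRedTerm n 0 k = 1 := by
      rw [tsum_congr (sphBesselJRedTerm_zero_right n), tsum_ite_eq]
    have hSK : ∑ k ∈ Finset.range (K + 1), sphBesselJRedTerm n 0 k = 1 := by
      rw [Finset.sum_congr rfl fun k _ => sphBesselJRedTerm_zero_right n k]
      simp
    rw [hS, hSK, sub_self, abs_zero]
    exact mul_nonneg (abs_nonneg _) (div_nonneg hρ0 (by linarith))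
  · have hp : 0 < |x ^ n / ((2 * n + 1)‼ : ℝ)| :=
      abs_pos.mpr (div_ne_zero (pow_ne_zero _ hx) (by positivity))
    have h := abs_sphBesselJ_sub_sum_le n K hρ hρ1
    rw [sphBesselJ_eq_prefactor_mul_tsum,
      Finset.sum_congr rfl fun k _ => sphBesselJTerm_eq_prefactor_mul_redTerm n x k,
      ← Finset.mul_sum, ← mul_sub, abs_mul, sphBesselJTerm_eq_prefactor_mul_redTerm, abs_mul,
      mul_assoc] at h
    exact le_of_mul_le_mul_left h hp

/-! ### The square-sum identity (A&S 10.1.50) -/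

/-- `G_n(x) = 2 iⁿ j_n(x)`. [cite: AbramowitzStegun1964, 10.1.14] -/
theorem gegenbauerIntegral_eq (n : ℕ) (x : ℝ) :
    gegenbauerIntegral n x = 2 * I ^ n * (sphBesselJ n x : ℂ) := by
  rw [ofReal_sphBesselJ]
  have h : I ^ n * (-I) ^ n = 1 := by rw [← mul_pow, mul_neg, I_mul_I, neg_neg, one_pow]
  linear_combination (-(gegenbauerIntegral n x)) * h

/-- `|G_n(x)| = 2 |j_n(x)|`. [cite: AbramowitzStegun1964, 10.1.14] -/
theorem norm_gegenbauerIntegral_eq (n : ℕ) (x : ℝ) :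
    ‖gegenbauerIntegral n x‖ = 2 * |sphBesselJ n x| := by
  rw [gegenbauerIntegral_eq, norm_mul, norm_mul, Complex.norm_two, norm_pow, norm_I, one_pow,
    mul_one, norm_real, Real.norm_eq_abs]

/-- `t ↦ e^{ixt}` lies in `L²([-1, 1])`. [cite: AbramowitzStegun1964, 10.1.47] -/
theorem memLp_cexp_I_mul (x : ℝ) : MemLp (fun t : ℝ => cexp (I * x * t)) 2 legendreMeasure :=
  memLp_legendreMeasure_of_continuous (by fun_prop) 2

/-- The Legendre coefficients of `e^{ixt}`: `⟨P̃_n, e^{ix·}⟩ = c_n G_n(x)` (`= 2 c_n iⁿ j_n(x)`,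
the Rayleigh expansion A&S 10.1.47). [cite: AbramowitzStegun1964, 10.1.47] -/
theorem inner_legendreL2_cexp (n : ℕ) (x : ℝ) :
    ⟪legendreL2 n, (memLp_cexp_I_mul x).toLp _⟫_ℂ = legendreNormConst n * gegenbauerIntegral n x := by
  rw [inner_legendreL2_left]
  have h1 : ∫ t, conj (legendreFn n t) * ((memLp_cexp_I_mul x).toLp _ : ℝ → ℂ) t ∂legendreMeasure =
      ∫ t, (legendreNormConst n : ℂ) * gegenbauerKernel n x t ∂legendreMeasure := by
    refine integral_congr_ae ?_
    filter_upwards [MemLp.coeFn_toLp (memLp_cexp_I_mul x)] with t ht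
    rw [ht, conj_legendreFn, legendreFn_apply, gegenbauerKernel]
    push_cast; ring
  rw [h1, MeasureTheory.integral_const_mul]
  congr 1
  rw [gegenbauerIntegral, intervalIntegral.integral_of_le (by norm_num : (-1 : ℝ) ≤ 1),
    ← integral_Icc_eq_integral_Ioc]

/-- `‖e^{ix·}‖²_{L²([-1,1])} = 2`. [cite: AbramowitzStegun1964, 10.1.50] -/
theorem norm_sq_toLp_cexp_I_mul (x : ℝ) : ‖(memLp_cexp_I_mul x).toLp _‖ ^ 2 = 2 := by
  rw [← inner_self_eq_norm_sq (𝕜 := ℂ), MeasureTheory.L2.inner_def]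
  have h1 : ∫ t, ⟪((memLp_cexp_I_mul x).toLp _ : ℝ → ℂ) t,
      ((memLp_cexp_I_mul x).toLp _ : ℝ → ℂ) t⟫_ℂ ∂legendreMeasure = ∫ t, (1 : ℂ) ∂legendreMeasure := by
    refine integral_congr_ae ?_
    filter_upwards [MemLp.coeFn_toLp (memLp_cexp_I_mul x)] with t ht
    rw [ht, RCLike.inner_apply, Complex.mul_conj', norm_cexp_I_mul_mul]
    simp
  rw [h1, MeasureTheory.integral_const, measureReal_def, legendreMeasure_univ]
  simp

/-- **The square-sum identity** `Σ_{n ≥ 0} (2n+1) j_n(x)² = 1` for every real `x` — Parseval for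
the Rayleigh expansion `e^{ixt} = Σ (2n+1) iⁿ j_n(x) P_n(t)` in `L²([-1, 1])`; in particular
`|j_0(x)| ≤ 1` and `|j_n(x)| ≤ (2n+1)^{-1/2}`. [cite: AbramowitzStegun1964, 10.1.50] -/
theorem hasSum_sq_sphBesselJ (x : ℝ) :
    HasSum (fun n : ℕ => (2 * n + 1) * sphBesselJ n x ^ 2) 1 := by
  have hP := hasSum_sq_legendreCoeff ((memLp_cexp_I_mul x).toLp _)
  simp_rw [inner_legendreL2_cexp, norm_mul, norm_real, Real.norm_eq_abs, norm_gegenbauerIntegral_eq,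
    norm_sq_toLp_cexp_I_mul] at hP
  have h2 := hP.div_const 2
  rw [show (2 : ℝ) / 2 = 1 by norm_num] at h2
  have h3 : (fun n : ℕ => (2 * (n : ℝ) + 1) * sphBesselJ n x ^ 2) =
      fun i => (|legendreNormConst i| * (2 * |sphBesselJ i x|)) ^ 2 / 2 := by
    funext n
    rw [mul_pow, mul_pow, sq_abs, sq_abs, legendreNormConst_sq]
    ring
  rw [h3]
  exact h2

/-- `(2n+1) j_n(x)² ≤ 1`. [cite: AbramowitzStegun1964, 10.1.50] -/
theorem sq_sphBesselJ_mul_le_one (n : ℕ) (x : ℝ) : (2 * n + 1) * sphBesselJ n x ^ 2 ≤ 1 := by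
  have h := hasSum_sq_sphBesselJ x
  calc (2 * (n : ℝ) + 1) * sphBesselJ n x ^ 2
      = ∑ i ∈ {n}, (2 * (i : ℝ) + 1) * sphBesselJ i x ^ 2 := by simp
    _ ≤ 1 := sum_le_hasSum {n} (fun i _ => by positivity) h

/-! ### The classical definition `j_n(x) = √(π/(2x)) J_{n+½}(x)` (A&S 10.1.1) -/

/-- **`j_n(x) = √(π/(2x)) J_{n+½}(x)` for `x > 0`**: the function defined here by Gegenbauer's integral
is the classical spherical Bessel function of the first kind (`J_ν` = the tree's `besselJC`, Watson's
series); this is what the program's optional Arb cross-check evaluates.  Proof: compare the ascending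
series 10.1.2 with Watson's series termwise, using `Γ(m + 3/2) = (2m+1)!! √π / 2^{m+1}`.
[cite: AbramowitzStegun1964, 10.1.1] [cite: Watson1944, §3.1 (8)] -/
theorem ofReal_sphBesselJ_eq_sqrt_mul_besselJC (n : ℕ) {x : ℝ} (hx : 0 < x) :
    (sphBesselJ n x : ℂ) =
      (Real.sqrt (π / (2 * x)) : ℂ) *
        Literature.Analysis.FunctionSpaces.besselJC ((n : ℂ) + 1 / 2) x := by
  have hx0 : (x : ℂ) ≠ 0 := ofReal_ne_zero.mpr hx.ne'
  have hJ := (Literature.Analysis.FunctionSpaces.hasSum_besselJC ((n : ℂ) + 1 / 2) hx0).mul_left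
    (Real.sqrt (π / (2 * x)) : ℂ)
  have hj : HasSum (fun k => (sphBesselJTerm n x k : ℂ)) (sphBesselJ n x : ℂ) :=
    Complex.hasSum_ofReal.mpr (hasSum_sphBesselJ n x)
  refine hj.unique (hJ.congr_fun fun k => ?_)
  -- the `k`-th terms agree
  have hπ : Real.sqrt π ≠ 0 := (Real.sqrt_pos.mpr Real.pi_pos).ne'
  have hsq : Real.sqrt (π / (2 * x)) * Real.sqrt (x / 2) = Real.sqrt π / 2 := by
    rw [← Real.sqrt_mul (by positivity), show π / (2 * x) * (x / 2) = π / 4 by field_simp; norm_num,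
      Real.sqrt_div Real.pi_pos.le, show (4 : ℝ) = 2 ^ 2 by norm_num,
      Real.sqrt_sq (by norm_num : (0 : ℝ) ≤ 2)]
  have hG : Complex.Gamma ((n : ℂ) + 1 / 2 + k + 1) =
      ((((2 * (n + k) + 1)‼ : ℕ) : ℝ) * Real.sqrt π / 2 ^ (n + k + 1) : ℝ) := by
    rw [show (n : ℂ) + 1 / 2 + k + 1 = ((((n + k : ℕ) : ℝ) + 1 + 1 / 2 : ℝ) : ℂ) by push_cast; ring,
      Complex.Gamma_ofReal, Real.Gamma_nat_add_one_add_half]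
  have hP : ((x : ℂ) / 2) ^ ((n : ℂ) + 1 / 2 + 2 * k) =
      (((x / 2) ^ (n + 2 * k) * Real.sqrt (x / 2) : ℝ) : ℂ) := by
    rw [show ((n : ℂ) + 1 / 2 + 2 * k) = ((((n + 2 * k : ℕ) : ℝ) + 1 / 2 : ℝ) : ℂ) by push_cast; ring,
      show ((x : ℂ) / 2) = ((x / 2 : ℝ) : ℂ) by push_cast; ring,
      ← Complex.ofReal_cpow (by positivity), Real.rpow_add (by positivity), Real.rpow_natCast,
      Real.sqrt_eq_rpow]
  have hreal : Real.sqrt (π / (2 * x)) *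
      ((-1) ^ k / ((k ! : ℝ) * ((((2 * (n + k) + 1)‼ : ℕ) : ℝ) * Real.sqrt π / 2 ^ (n + k + 1))) *
        ((x / 2) ^ (n + 2 * k) * Real.sqrt (x / 2))) = sphBesselJTerm n x k := by
    have e1 : Real.sqrt (π / (2 * x)) *
        ((-1) ^ k / ((k ! : ℝ) * ((((2 * (n + k) + 1)‼ : ℕ) : ℝ) * Real.sqrt π / 2 ^ (n + k + 1))) *
          ((x / 2) ^ (n + 2 * k) * Real.sqrt (x / 2))) =
        (Real.sqrt (π / (2 * x)) * Real.sqrt (x / 2)) *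
          ((-1) ^ k * 2 ^ (n + k + 1) * (x / 2) ^ (n + 2 * k) /
            ((k ! : ℝ) * (((2 * (n + k) + 1)‼ : ℕ) : ℝ) * Real.sqrt π)) := by
      field_simp
    have hD : ((((2 * n + 2 * k + 1)‼ : ℕ) : ℝ)) ≠ 0 := by positivity
    rw [e1, hsq, sphBesselJTerm_def, div_pow, show 2 * (n + k) + 1 = 2 * n + 2 * k + 1 by ring]
    field_simp
    ring
  rw [hG, hP, ← hreal]
  push_cast
  ring

/-- The same as a real identity: `j_n(x) = Re(√(π/(2x)) J_{n+½}(x))` for `x > 0`.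
[cite: AbramowitzStegun1964, 10.1.1] -/
theorem sphBesselJ_eq_re_sqrt_mul_besselJC (n : ℕ) {x : ℝ} (hx : 0 < x) :
    sphBesselJ n x =
      ((Real.sqrt (π / (2 * x)) : ℂ) *
        Literature.Analysis.FunctionSpaces.besselJC ((n : ℂ) + 1 / 2) x).re := by
  rw [← ofReal_sphBesselJ_eq_sqrt_mul_besselJC n hx, ofReal_re]

end Literature.Analysis.SpecialFunctions
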